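import Mathlib.Analysis.InnerProductSpace.Calculus
import Mathlib.Analysis.SpecialFunctions.SmoothTransition
import Literature.Analysis.FunctionSpaces.SobolevTraceGraph
import Literature.Analysis.FunctionSpaces.SobolevTraceOperator
import HarnessLib

/-!
# Proof of the trace theorem on bounded Lipschitz domains (`Literature.Analysis.FunctionSpaces.trace_theorem`)

`Literature.Analysis.FunctionSpaces.SobolevTrace` states the trace theorem as the named fact
`Literature.trace_theorem F`: on a bounded Lipschitz domain `Ω` of a finite-dimensional real inner
product space, for `1 ≤ p < ∞` and an additive Haar measure `μ`, the hypothesis structure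
`TraceData F Ω p μ (surfaceMeasure Ω)` is inhabited — a bounded, a.e.-linear trace
`W^{1,p}(Ω; F) → L^p(∂Ω, μH[n-1]; F)` restricting smooth functions and with kernel `W₀^{1,p}(Ω)`
(E. Gagliardo 1957; Evans, *PDE*, §5.5, Theorems 1–2; Alt, *Linear functional analysis*,
A8.6 and A8.10). This file completes its proof:

* `Literature.trace_theorem_holds : trace_theorem F` for complete `F`.

The reduction `trace_theorem_of_parts` (`SobolevTraceOperator`) leaves two analytic inputs,
vendored there as named facts. The first, the trace inequality for `C¹` functions
(`eLpNorm_surfaceMeasure_le_of_contDiff`, Evans–Gariepy (1992), §4.3, Theorem 1, `(⋆⋆⋆)`), is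
`LipGraph.exists_eLpNorm_surfaceMeasure_le_of_contDiff` of `SobolevTraceGraph`; its discharge
`eLpNorm_surfaceMeasure_le_of_contDiff_holds` is a one-liner below. The second,

* `Literature.memSobolevDomainZero_of_tendsto_trace_zero F` — a `W^{1,p}(Ω)` function which is the
  `W^{1,p}`-limit of `C¹` functions with `L^p(∂Ω)`-vanishing boundary values lies in
  `W₀^{1,p}(Ω)` (Alt (2016), A8.10, inclusion `⊇`; Evans (2010), §5.5, Theorem 2),

is proved here (`TraceZero.memSobolevDomainZero_of_tendsto_trace_zero'`,
discharge `memSobolevDomainZero_of_tendsto_trace_zero_holds`).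

## Proof of the kernel characterisation (Evans, *PDE*, §5.5, proof of Theorem 2, on Lipschitz charts)

Let `f ∈ W^{1,p}(Ω)`, `φₙ ∈ C¹(E')` with `‖f - φₙ‖_{W^{1,p}(Ω)} → 0` and `‖φₙ‖_{L^p(∂Ω)} → 0`.

1. *`W₀^{1,p}(Ω)` is a closed subspace* (section `Closure`): closed under finite sums and under
   `W^{1,p}(Ω)`-limits (diagonal argument), and it only depends on values on `Ω`.
2. *Interior pieces* (section `Interior`, Evans's last step "mollify"): for `ζ ∈ C_c^∞` with
   `supp ζ ⊆ Ω`, `ζ f ∈ W₀^{1,p}(Ω)` — the interior mollifications `ψₙ` of `𝟙_Ω ζ f`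
   (`SobolevApprox.exists_smooth_approx_smul_of_tsupport_subset`, `SobolevTraceDensityProofs`)
   multiplied by a fixed `χ ∈ C_c^∞(Ω)`, `χ = 1` on `supp ζ` (smooth Urysohn,
   `exists_smooth_one_of_isCompact_subset`), are test functions on `Ω` converging to `ζ f`.
3. *Localisation* (section `Localise`): for `ρ ∈ C_c^∞`, `ρ φₙ → ρ f` and
   `D(ρ φₙ) → ρ Df + Dρ ⊗ f` in `L^p(Ω)` and `‖ρ φₙ‖_{L^p(∂Ω)} → 0`; here `Dφₙ → Df` in `L^p(Ω)`
   because classical derivatives are weak derivatives and weak derivatives are a.e. unique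
   (`tendsto_eLpNorm_fderiv_sub_of_contDiff`).
4. *The zero-trace strip estimate* (section `StripLimit`; Evans, (9)–(10); Alt, A8.10 with A8.9):
   in a chart where `Ω` is the epigraph of `γ` in the direction `u`, the strip
   `S(ρ, τ) = {Γ z + s u | Γ z ∈ B(x₀, ρ), 0 < s < τ}` of height `τ` above the boundary patch
   satisfies, for `g ∈ L^p(Ω)` with weak derivative `G` and `C¹` approximants as in 3,
   `∫_S ‖g‖^p ≤ 2^{p-1} τ^p ∫_S ‖G‖^p`: the `C¹` estimate
   `c ∫_S ‖φ‖^p ≤ 2^{p-1}(τ ∫_{∂Ω} ‖φ‖^p dμH[n-1] + τ^p c ∫_S ‖Dφ‖^p)` of `SobolevTraceGraph`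
   (`LipGraph.sliceConst_mul_setLIntegral_strip_le_of_contDiff`: FTC upwards from the graph,
   Jensen, slicing, and the lower graph bound `Γ_* λ ≤ μH[n-1]⌊∂Ω`) passes to the limit, the
   boundary term vanishing; hence `‖g‖_{L^p(S)} ≤ 2 τ ‖G‖_{L^p(S)}` (`eLpNorm_strip_le`).
5. *Smooth cut-offs along a Lipschitz graph* (section `Cutoff`, replacing Evans's `ζ(m x_n)`
   in flattened coordinates): with a smooth profile `η` (`1` on `(-∞, 1/2]`, `0` on `[1, ∞)`) and
   the mollification `θ_ε = ρ_ε ⋆ (γ ∘ proj u)` of the `K`-Lipschitz height reference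
   (`|θ_ε - γ ∘ proj u| ≤ K ε`, `‖Dθ_ε‖ ≤ K`, `exists_smooth_near_lipschitz`), the function
   `ζ_τ(y) = η((2/τ)(⟪y, u⟫ - θ_ε(y)))`, `K ε ≤ τ/8`, is smooth, `= 1` where the height
   `⟪y, u⟫ - γ(proj u y)` is `≤ τ/8`, `= 0` where it is `≥ 3τ/4`, and `‖Dζ_τ‖ ≤ C(K)/τ`
   (`exists_smooth_cutoff`).
6. *Boundary pieces* (`memSobolevDomainZero_smul_of_chart`): for `ρ ∈ C_c^∞(B(x₀, r/2))`,
   `g = ρ f` has weak derivative `G = ρ Df + Dρ ⊗ f`; the functions `(1 - ζ_{τ_m}) ρ f`,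
   `τ_m → 0`, are cut-off `W^{1,p}` functions with support in `Ω` (`tsupport_cutoff_mul_subset`),
   hence in `W₀^{1,p}(Ω)` by 2, and `g - (1 - ζ) ρ f = ζ g` with
   `‖ζ g‖_{W^{1,p}(Ω)} ≤ ‖g‖_{L^p(S)} + Σᵢ (‖eᵢ‖ ‖G‖_{L^p(S)} + (C/τ)‖eᵢ‖ ‖g‖_{L^p(S)})`,
   `S = S(r/2 + τ, τ)` (`eSobolevDomainNorm_cutoff_smul_le`: every term of `ζ g` and of
   `D(ζ g) = ζ G + Dζ ⊗ g` is supported in the strip), which by 4 is `≤ C' ‖G‖_{L^p(S_m)} → 0`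
   as the strips shrink to the empty set (`tendsto_eLpNorm_restrict_of_antitone`). By 1,
   `ρ f ∈ W₀^{1,p}(Ω)`.
7. *Assembly* (`memSobolevDomainZero_of_tendsto_trace_zero'`): a smooth partition of unity on `Ω̄`
   subordinate to `Ω` and finitely many half chart balls
   (`SmoothPartitionOfUnity.exists_isSubordinate`, as in the density theorem of
   `SobolevTraceDensityProofs`), pieces by 2 and 6, `f = Σᵢ ρᵢ f` on `Ω`, and 1.

## Remarks

* *Completeness.* `trace_theorem F` quantifies over an arbitrary real normed space `F` but is
  meaningful (and true) only for complete `F`: for non-complete `F` Mathlib's Bochner integral is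
  the junk value `0`, every `L^p` function is then in "`W₀^{1,p}`", and a `TraceData` would force
  all constants to vanish on `∂Ω`. Accordingly `trace_theorem_holds`, like the accepted
  `morrey_embedding_holds` (`SobolevTraceProofs`) and `trace_theorem_of_parts`, assumes
  `[CompleteSpace F]`; the kernel fact carries `∀ [CompleteSpace F]` in its statement. The trace
  inequality needs no completeness.
* *Lipschitz versus `C¹` boundaries.* Evans flattens a `C¹` boundary; for Lipschitz `γ` the
  vertical shear `(z, s) ↦ Γ z + s u` is only bi-Lipschitz, so no change of variables in
  `W^{1,p}` is used: all estimates are along the vertical segments (where `φₙ` is `C¹`) and are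
  transported by the slicing formula of `SobolevTraceGraph`; the only smoothing of `γ` is in the
  construction of the cut-offs (step 5). Alt, A8.10, argues the same way (A8.9: `η(h⁻¹ dist)`).
* *Constants.* `μH` is Mathlib's unnormalised Hausdorff measure and `μ` any additive Haar
  measure; all constants are absorbed (`LipGraph.sliceConst`).

## Mathlib search

Mathlib (this pin) provides the ingredients used here — `Real.smoothTransition`, `ContDiffBump`
mollifiers (`ContDiffBump.dist_normed_convolution_le`, `HasCompactSupport.contDiff_convolution_left`),
`norm_fderiv_le_of_lipschitz`, smooth partitions of unity and smooth Urysohn functions on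
manifolds (`SmoothPartitionOfUnity.exists_isSubordinate`, `exists_contMDiffMap_zero_one_of_isClosed`),
`tendsto_setLIntegral_zero`, `tendsto_measure_iInter_atTop` — but no Sobolev spaces on domains,
no `W₀^{1,p}`, and no traces (`lean search` for `trace`, `Sobolev` in `MeasureTheory/`,
`Analysis/`: only the Bessel-potential spaces of `Analysis/Distribution/Sobolev` on the whole
space). The weak-derivative calculus is the tree's (`SobolevDomain`, `SobolevDomainProofs`,
`SobolevTraceDensityProofs`, `SobolevTraceDensityHigherProofs`: product rule, algebra and
`Ω`-locality of the `W^{k,p}` norm, interior mollification), imported, not restated; the only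
re-proved variant is `tendsto_eLpNorm_fderiv_sub_of_contDiff` (the `C¹`, rather than
test-function, version of `Literature.Analysis.FunctionSpaces.tendsto_eLpNorm_fderiv_of_tendsto_eSobolevDomainNorm` of
`SobolevDomainGNSProofs`, whose hypothesis is stronger than needed).

## References

* L. C. Evans, *Partial Differential Equations*, 2nd ed., Graduate Studies in Mathematics 19,
  AMS (2010), §5.5, Theorem 1 (trace theorem) and Theorem 2 (trace-zero functions in
  `W^{1,p}`) with their proofs; §5.2.3 Theorem 1 (iv) (product rule).
* H. W. Alt, *Linear Functional Analysis. An Application-Oriented Introduction*, Universitext,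
  Springer (2016), A8.6 (trace theorem), A8.9, A8.10 Lemma (`W₀^{1,p}(Ω) = {u ; Su = 0}`).
* L. C. Evans, R. F. Gariepy, *Measure Theory and Fine Properties of Functions*, CRC Press
  (1992), §4.3, Theorem 1 (revised ed. 2015: Theorem 4.6).
* E. Gagliardo, *Caratterizzazioni delle tracce sulla frontiera relative ad alcune classi di
  funzioni in n variabili*, Rend. Sem. Mat. Univ. Padova 27 (1957), 284–305.
-/

noncomputable section

open MeasureTheory MeasureTheory.Measure TopologicalSpace Filter ENNReal Bornology Set Metric Module
  Function
open scoped Topology NNReal InnerProductSpace ContDiff Manifold Convolution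

namespace Literature.Analysis.FunctionSpaces

namespace TraceZero


/-! ### `W₀^{1,p}(Ω)`: closure properties -/

section Closure

variable {E' : Type*} [NormedAddCommGroup E'] [NormedSpace ℝ E'] [MeasurableSpace E']
  [BorelSpace E'] [FiniteDimensional ℝ E']
variable {F : Type*} [NormedAddCommGroup F] [NormedSpace ℝ F]
variable {Ω : Opens E'} {μ : Measure E'} {p : ℝ≥0∞}

omit [MeasurableSpace E'] [BorelSpace E'] [FiniteDimensional ℝ E'] in
/-- Test functions on `Ω` form a vector space: sums (Evans, *PDE*, §5.2.1). [folklore] -/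
theorem isTestFunctionOn_add {φ ψ : E' → F} (hφ : IsTestFunctionOn Ω φ)
    (hψ : IsTestFunctionOn Ω ψ) : IsTestFunctionOn Ω (φ + ψ) :=
  ⟨hφ.contDiff.add hψ.contDiff, hφ.hasCompactSupport.add hψ.hasCompactSupport,
    (tsupport_add φ ψ).trans (union_subset hφ.tsupport_subset hψ.tsupport_subset)⟩

omit [MeasurableSpace E'] [BorelSpace E'] [FiniteDimensional ℝ E'] in
/-- A smooth compactly supported scalar multiple of a smooth function, with the scalar factor
supported in `Ω`, is a test function on `Ω` (Evans, *PDE*, §5.2.1). [folklore] -/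
theorem isTestFunctionOn_smul {χ : E' → ℝ} {ψ : E' → F} (hχ : ContDiff ℝ ∞ χ)
    (hχc : HasCompactSupport χ) (hχΩ : tsupport χ ⊆ (Ω : Set E')) (hψ : ContDiff ℝ ∞ ψ) :
    IsTestFunctionOn Ω (fun x => χ x • ψ x) :=
  ⟨hχ.smul hψ, hχc.smul_right (f' := ψ), (tsupport_smul_subset_left χ ψ).trans hχΩ⟩

/-- `W₀^{1,p}(Ω)` only depends on the values on `Ω`. [folklore] -/
theorem memSobolevDomainZero_congr_eqOn {f g : E' → F} (hf : MemSobolevDomainZero p Ω μ f)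
    (hg : MemSobolevDomain 1 p Ω μ g) (h : EqOn f g (Ω : Set E')) :
    MemSobolevDomainZero p Ω μ g := by
  obtain ⟨_, φ, hφ, hlim⟩ := hf
  refine ⟨hg, φ, hφ, ?_⟩
  refine hlim.congr fun n => (SobolevApprox.eSobolevDomainNorm_congr fun x hx => ?_).symm
  simp only [Pi.sub_apply, h hx]

omit [BorelSpace E'] in
/-- The zero function is in `W₀^{1,p}(Ω)`. [folklore] -/
theorem memSobolevDomainZero_zero : MemSobolevDomainZero p Ω μ (0 : E' → F) :=
  ⟨⟨MemLp.zero' , 0, SobolevApprox.hasWeakFDerivOn_zero, fun _ => MemLp.zero'⟩,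
    fun _ => 0, fun _ => isTestFunctionOn_zero Ω, by simp [SobolevApprox.eSobolevDomainNorm_zero_fun]⟩

/-- **`W₀^{1,p}(Ω)` is closed under addition** (it is the closure of a subspace; Evans, *PDE*,
§5.2.2). [folklore] -/
theorem memSobolevDomainZero_add (hp : 1 ≤ p) {f g : E' → F} (hf : MemSobolevDomainZero p Ω μ f)
    (hg : MemSobolevDomainZero p Ω μ g) : MemSobolevDomainZero p Ω μ (f + g) := by
  obtain ⟨hfW, φ, hφ, hφlim⟩ := hf
  obtain ⟨hgW, ψ, hψ, hψlim⟩ := hg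
  refine ⟨SobolevApprox.memSobolevDomain_add hfW hgW, fun n => φ n + ψ n,
    fun n => isTestFunctionOn_add (hφ n) (hψ n), ?_⟩
  have hle : ∀ n, eSobolevDomainNorm 1 p Ω μ (f + g - (φ n + ψ n)) ≤
      eSobolevDomainNorm 1 p Ω μ (f - φ n) + eSobolevDomainNorm 1 p Ω μ (g - ψ n) := fun n => by
    rw [add_sub_add_comm]
    exact SobolevApprox.eSobolevDomainNorm_add_le
      (hfW.memLp.aestronglyMeasurable.sub (hφ n).contDiff.continuous.aestronglyMeasurable)
      (hgW.memLp.aestronglyMeasurable.sub (hψ n).contDiff.continuous.aestronglyMeasurable) hp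
  refine tendsto_of_tendsto_of_tendsto_of_le_of_le tendsto_const_nhds ?_ (fun _ => bot_le) hle
  simpa using hφlim.add hψlim

/-- `W₀^{1,p}(Ω)` is closed under finite sums. [folklore] -/
theorem memSobolevDomainZero_sum (hp : 1 ≤ p) {ι : Type*} (s : Finset ι) {f : ι → E' → F}
    (h : ∀ i ∈ s, MemSobolevDomainZero p Ω μ (f i)) :
    MemSobolevDomainZero p Ω μ (∑ i ∈ s, f i) := by
  classical
  induction s using Finset.induction_on with
  | empty => simpa using memSobolevDomainZero_zero
  | insert a s ha ih =>
    rw [Finset.sum_insert ha]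
    exact memSobolevDomainZero_add hp (h a (Finset.mem_insert_self a s))
      (ih fun i hi => h i (Finset.mem_insert_of_mem hi))

/-- **`W₀^{1,p}(Ω)` is closed in `W^{1,p}(Ω)`** (by definition it is a closure; Evans, *PDE*,
§5.2.2, Definition of `W₀^{k,p}`): a `W^{1,p}(Ω)`-limit of `W₀^{1,p}(Ω)` functions is in
`W₀^{1,p}(Ω)` (diagonal argument). [folklore] -/
theorem memSobolevDomainZero_of_tendsto (hp : 1 ≤ p) {f : E' → F}
    (hf : MemSobolevDomain 1 p Ω μ f) {g : ℕ → E' → F}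
    (hg : ∀ n, MemSobolevDomainZero p Ω μ (g n))
    (hfg : Tendsto (fun n => eSobolevDomainNorm 1 p Ω μ (f - g n)) atTop (𝓝 0)) :
    MemSobolevDomainZero p Ω μ f := by
  have hε : ∀ n : ℕ, (0 : ℝ≥0∞) < ((n : ℝ≥0∞) + 1)⁻¹ := fun n =>
    ENNReal.inv_pos.2 (by simp)
  have hex : ∀ n : ℕ, ∃ ψ : E' → F, IsTestFunctionOn Ω ψ ∧
      eSobolevDomainNorm 1 p Ω μ (g n - ψ) < ((n : ℝ≥0∞) + 1)⁻¹ := fun n => by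
    obtain ⟨_, φ, hφ, hφlim⟩ := hg n
    obtain ⟨k, hk⟩ := ((tendsto_order.1 hφlim).2 _ (hε n)).exists
    exact ⟨φ k, hφ k, hk⟩
  choose ψ hψ hψlt using hex
  refine ⟨hf, ψ, hψ, ?_⟩
  have hle : ∀ n, eSobolevDomainNorm 1 p Ω μ (f - ψ n) ≤
      eSobolevDomainNorm 1 p Ω μ (f - g n) + ((n : ℝ≥0∞) + 1)⁻¹ := fun n => by
    calc eSobolevDomainNorm 1 p Ω μ (f - ψ n)
        = eSobolevDomainNorm 1 p Ω μ ((f - g n) + (g n - ψ n)) := by rw [sub_add_sub_cancel]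
      _ ≤ eSobolevDomainNorm 1 p Ω μ (f - g n) + eSobolevDomainNorm 1 p Ω μ (g n - ψ n) :=
          SobolevApprox.eSobolevDomainNorm_add_le
            (hf.memLp.aestronglyMeasurable.sub (hg n).1.memLp.aestronglyMeasurable)
            ((hg n).1.memLp.aestronglyMeasurable.sub
              (hψ n).contDiff.continuous.aestronglyMeasurable) hp
      _ ≤ _ := add_le_add le_rfl (hψlt n).le
  have h0 : Tendsto (fun n : ℕ => ((n : ℝ≥0∞) + 1)⁻¹) atTop (𝓝 0) := by
    have := ENNReal.tendsto_inv_nat_nhds_zero.comp (tendsto_add_atTop_nat 1)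
    simpa [Function.comp_def, Nat.cast_add, Nat.cast_one] using this
  refine tendsto_of_tendsto_of_tendsto_of_le_of_le tendsto_const_nhds ?_ (fun _ => bot_le) hle
  simpa using hfg.add h0

end Closure

/-! ### Smooth Urysohn functions -/

section Urysohn

variable {E' : Type*} [NormedAddCommGroup E'] [NormedSpace ℝ E'] [FiniteDimensional ℝ E']

/-- **Smooth Urysohn function for a compact set inside an open set**: for compact `K ⊆ U` open
in a finite-dimensional space there is `χ ∈ C_c^∞(U)` with `0 ≤ χ ≤ 1` and `χ = 1` on `K`
(Mathlib's `exists_contMDiffMap_zero_one_of_isClosed` applied to `K` and the complement of a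
thickening of `K` inside `U`). [folklore] -/
theorem exists_smooth_one_of_isCompact_subset {K U : Set E'} (hK : IsCompact K) (hU : IsOpen U)
    (hKU : K ⊆ U) :
    ∃ χ : E' → ℝ, ContDiff ℝ ∞ χ ∧ HasCompactSupport χ ∧ tsupport χ ⊆ U ∧ EqOn χ 1 K ∧
      ∀ x, χ x ∈ Icc (0 : ℝ) 1 := by
  obtain ⟨δ, hδ, hδU⟩ := hK.exists_cthickening_subset_open hU hKU
  obtain ⟨f, hf0, hf1, hf01⟩ := exists_contMDiffMap_zero_one_of_isClosed (I := 𝓘(ℝ, E'))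
    (M := E') (n := ⊤) (isClosed_compl_iff.2 isOpen_thickening) hK.isClosed
    (disjoint_compl_left_iff_subset.2 (self_subset_thickening hδ K))
  have hsupp : support f ⊆ thickening δ K := fun x hx => by
    by_contra h
    exact hx (hf0 h)
  have htsupp : tsupport f ⊆ cthickening δ K :=
    (closure_mono hsupp).trans (closure_thickening_subset_cthickening δ K)
  refine ⟨f, contMDiff_iff_contDiff.1 f.contMDiff, ?_, htsupp.trans hδU, hf1, hf01⟩
  exact IsCompact.of_isClosed_subset hK.cthickening (isClosed_tsupport _) htsupp

end Urysohn

/-! ### Compactly supported cut-offs of `W^{1,p}` functions are in `W₀^{1,p}(Ω)` -/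

section LpBounds

variable {E' : Type*} [NormedAddCommGroup E'] [NormedSpace ℝ E'] [MeasurableSpace E']
variable {F : Type*} [NormedAddCommGroup F] [NormedSpace ℝ F] {p : ℝ≥0∞}

omit [NormedAddCommGroup E'] [NormedSpace ℝ E'] [MeasurableSpace E'] in
/-- `L^p` bound for a scalar multiple by a bounded function: `‖χ • h‖_p ≤ C ‖h‖_p` if `|χ| ≤ C`.
[folklore] -/
theorem eLpNorm_smul_le_of_bound {X : Type*} [MeasurableSpace X] {ν : Measure X} {χ : X → ℝ}
    {C : ℝ} (hC : ∀ x, ‖χ x‖ ≤ C) (h : X → F) :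
    eLpNorm (fun x => χ x • h x) p ν ≤ ENNReal.ofReal C * eLpNorm h p ν :=
  eLpNorm_le_mul_eLpNorm_of_ae_le_mul (Eventually.of_forall fun x => by
    rw [norm_smul]; exact mul_le_mul_of_nonneg_right (hC x) (norm_nonneg _)) p

/-- `L^p` bound for the rank-one term of the product rule: `‖(Dχ x ⊗ h x) v‖_p ≤ C ‖v‖ ‖h‖_p` if
`‖Dχ‖ ≤ C`. [folklore] -/
theorem eLpNorm_fderiv_apply_smul_le_of_bound {ν : Measure E'} {χ : E' → ℝ} {C : ℝ}
    (hC : ∀ x, ‖fderiv ℝ χ x‖ ≤ C) (h : E' → F) (v : E') :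
    eLpNorm (fun x => (fderiv ℝ χ x v) • h x) p ν ≤ ENNReal.ofReal (C * ‖v‖) * eLpNorm h p ν :=
  eLpNorm_le_mul_eLpNorm_of_ae_le_mul (Eventually.of_forall fun x => by
    rw [norm_smul]
    refine mul_le_mul_of_nonneg_right ?_ (norm_nonneg _)
    exact (ContinuousLinearMap.le_opNorm _ _).trans
      (mul_le_mul_of_nonneg_right (hC x) (norm_nonneg _))) p

end LpBounds

section Interior

variable {E' : Type*} [NormedAddCommGroup E'] [NormedSpace ℝ E'] [MeasurableSpace E']
  [BorelSpace E'] [FiniteDimensional ℝ E']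
variable {F : Type*} [NormedAddCommGroup F] [NormedSpace ℝ F] [CompleteSpace F]
variable {Ω : Opens E'} {μ : Measure E'} [μ.IsAddHaarMeasure] {p : ℝ≥0∞}

omit [CompleteSpace F] [μ.IsAddHaarMeasure] in
/-- **`W^{1,p}` convergence of cut-off products.** If `hₙ` has weak derivative `gₙ` on `Ω` with
`‖hₙ‖_{L^p(Ω)} → 0` and `‖gₙ v‖_{L^p(Ω)} → 0` for all `v`, and `χ` is smooth with `χ`, `Dχ`
bounded, then `‖χ hₙ‖_{W^{1,p}(Ω)} → 0` (product rule `D(χ h) = χ Dh + Dχ ⊗ h`, Evans, *PDE*,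
§5.2.3, Theorem 1 (iv)). [folklore] -/
theorem tendsto_eSobolevDomainNorm_smul (hp : 1 ≤ p) {χ : E' → ℝ} (hχ : ContDiff ℝ ∞ χ)
    {C₀ C₁ : ℝ}
    (hC₀ : ∀ x, ‖χ x‖ ≤ C₀) (hC₁ : ∀ x, ‖fderiv ℝ χ x‖ ≤ C₁) {h : ℕ → E' → F}
    {g : ℕ → E' → E' →L[ℝ] F} (hw : ∀ n, HasWeakFDerivOn Ω μ (h n) (g n))
    (hlim : Tendsto (fun n => eLpNorm (h n) p (μ.restrict Ω)) atTop (𝓝 0))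
    (hlimD : ∀ v, Tendsto (fun n => eLpNorm (fun x => g n x v) p (μ.restrict Ω)) atTop (𝓝 0)) :
    Tendsto (fun n => eSobolevDomainNorm 1 p Ω μ (fun x => χ x • h n x)) atTop (𝓝 0) := by
  set b := Module.finBasis ℝ E'
  have hW : ∀ n, HasWeakFDerivOn Ω μ (fun x => χ x • h n x)
      (fun x => χ x • g n x + (fderiv ℝ χ x).smulRight (h n x)) := fun n =>
    SobolevApprox.hasWeakFDerivOn_smul (hw n) hχ
  have hbound : ∀ n, eSobolevDomainNorm 1 p Ω μ (fun x => χ x • h n x) ≤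
      ENNReal.ofReal C₀ * eLpNorm (h n) p (μ.restrict Ω) +
        ∑ i, (ENNReal.ofReal C₀ * eLpNorm (fun x => g n x (b i)) p (μ.restrict Ω) +
          ENNReal.ofReal (C₁ * ‖b i‖) * eLpNorm (h n) p (μ.restrict Ω)) := by
    intro n
    refine (SobolevApprox.eSobolevDomainNorm_one_le (hW n)).trans (add_le_add
      (eLpNorm_smul_le_of_bound hC₀ _) (Finset.sum_le_sum fun i _ => ?_))
    have heq : (fun x => (χ x • g n x + (fderiv ℝ χ x).smulRight (h n x)) (b i)) =
        (fun x => χ x • g n x (b i)) + fun x => (fderiv ℝ χ x (b i)) • h n x := by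
      ext x
      simp [ContinuousLinearMap.smulRight_apply]
    rw [heq]
    refine (eLpNorm_add_le ?_ ?_ hp).trans ?_
    · exact hχ.continuous.aestronglyMeasurable.smul
        (SobolevApprox.locallyIntegrableOn_deriv_apply (hw n) _).aestronglyMeasurable
    · exact ((hχ.continuous_fderiv (by simp)).clm_apply continuous_const).aestronglyMeasurable.smul
        (hw n).locallyIntegrableOn.aestronglyMeasurable
    · exact add_le_add (eLpNorm_smul_le_of_bound hC₀ _)
        (eLpNorm_fderiv_apply_smul_le_of_bound hC₁ _ _)
  have hlim0 : Tendsto (fun n => ENNReal.ofReal C₀ * eLpNorm (h n) p (μ.restrict Ω) +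
      ∑ i, (ENNReal.ofReal C₀ * eLpNorm (fun x => g n x (b i)) p (μ.restrict Ω) +
        ENNReal.ofReal (C₁ * ‖b i‖) * eLpNorm (h n) p (μ.restrict Ω))) atTop (𝓝 0) := by
    have h1 := ENNReal.Tendsto.const_mul hlim (Or.inr ENNReal.ofReal_ne_top)
      (a := ENNReal.ofReal C₀)
    have h2 := tendsto_finsetSum Finset.univ fun i (_ : i ∈ Finset.univ) =>
      (ENNReal.Tendsto.const_mul (hlimD (b i)) (Or.inr ENNReal.ofReal_ne_top)
        (a := ENNReal.ofReal C₀)).add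
        (ENNReal.Tendsto.const_mul hlim (Or.inr ENNReal.ofReal_ne_top)
          (a := ENNReal.ofReal (C₁ * ‖b i‖)))
    simpa using h1.add h2
  exact tendsto_of_tendsto_of_tendsto_of_le_of_le tendsto_const_nhds hlim0 (fun _ => bot_le) hbound

/-- **Interior patches are in `W₀^{1,p}(Ω)`** (Evans, *PDE*, §5.5, proof of Theorem 2, last
step: "mollify to produce `u_m ∈ C_c^∞(U)`"; Adams, *Sobolev Spaces* (1975), Lemma 3.15): for
`f ∈ W^{1,p}(Ω)`, `1 ≤ p < ∞`, and `ζ ∈ C_c^∞` with `supp ζ ⊆ Ω`, the function `ζ f` lies in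
`W₀^{1,p}(Ω)`. The mollifications `ψₙ` of `𝟙_Ω ζ f` converge to `ζ f` in `W^{1,p}(Ω)`
(`SobolevApprox.exists_smooth_approx_smul_of_tsupport_subset`); multiplied by a fixed
`χ ∈ C_c^∞(Ω)` with `χ = 1` on `supp ζ` they become test functions on `Ω`, and
`ζ f - χ ψₙ = χ (ζ f - ψₙ) → 0` in `W^{1,p}(Ω)`. [folklore] -/
theorem memSobolevDomainZero_smul_of_tsupport_subset (hp : 1 ≤ p) (hp' : p ≠ ⊤) {f : E' → F}
    (hf : MemSobolevDomain 1 p Ω μ f) {ζ : E' → ℝ} (hζ : ContDiff ℝ ∞ ζ)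
    (hζc : HasCompactSupport ζ) (hζΩ : tsupport ζ ⊆ (Ω : Set E')) :
    MemSobolevDomainZero p Ω μ (fun x => ζ x • f x) := by
  have hmem : MemSobolevDomain 1 p Ω μ (fun x => ζ x • f x) :=
    SobolevApprox.memSobolevDomain_smul hf hζ hζc
  obtain ⟨hf0, Df, hDf, hDfp⟩ := hf
  simp only [memSobolevDomain_zero_iff] at hDfp
  obtain ⟨ψ, g, hψ, hwg, hlim, hlimD⟩ :=
    SobolevApprox.exists_smooth_approx_smul_of_tsupport_subset hp hp' hf0 hDf hDfp hζ hζc hζΩ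
  obtain ⟨χ, hχ, hχc, hχΩ, hχ1, -⟩ :=
    exists_smooth_one_of_isCompact_subset hζc Ω.isOpen hζΩ
  -- bounds for `χ` and `Dχ`
  obtain ⟨C₀, hC₀⟩ := hχ.continuous.bounded_above_of_compact_support hχc
  obtain ⟨C₁, hC₁⟩ := (hχ.continuous_fderiv (by simp)).bounded_above_of_compact_support
    (hχc.fderiv ℝ)
  -- the test functions `χ ψₙ`
  refine ⟨hmem, fun n x => χ x • ψ n x, fun n => isTestFunctionOn_smul hχ hχc hχΩ (hψ n), ?_⟩
  -- `ζ f - χ ψₙ = χ (ζ f - ψₙ)` everywhere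
  have hid : ∀ n, ((fun x => ζ x • f x) - fun x => χ x • ψ n x) =
      fun x => χ x • ((fun x => ζ x • f x) - ψ n) x := by
    intro n
    ext x
    by_cases hx : x ∈ tsupport ζ
    · simp [hχ1 hx]
    · simp [image_eq_zero_of_notMem_tsupport hx]
  simp only [hid]
  exact tendsto_eSobolevDomainNorm_smul hp hχ hC₀ hC₁ hwg hlim hlimD

end Interior



/-! ### A smooth profile: `1` on `(-∞, 1/2]`, `0` on `[1, ∞)` -/

section Profile

/-- **A smooth cut-off profile**: there is `η ∈ C^∞(ℝ)` with `0 ≤ η ≤ 1`, `η = 1` on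
`(-∞, 1/2]`, `η = 0` on `[1, ∞)` and bounded derivative — e.g. `η(t) = smoothTransition (2 - 2t)`
(Mathlib's `Real.smoothTransition`), whose derivative is continuous and vanishes off `[1/2, 1]`
(the function `ζ` of Evans, *PDE*, §5.5, proof of Theorem 2: "`ζ ≡ 1` on `[0, 1]`, `ζ ≡ 0` on
`ℝ - [0, 2]`, `0 ≤ ζ ≤ 1`", rescaled). [folklore] -/
theorem exists_smooth_profile : ∃ η : ℝ → ℝ, ContDiff ℝ ∞ η ∧ (∀ t, η t ∈ Icc (0 : ℝ) 1) ∧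
    (∀ t, t ≤ 1 / 2 → η t = 1) ∧ (∀ t, 1 ≤ t → η t = 0) ∧
    ∃ M : ℝ, 0 ≤ M ∧ ∀ t, ‖fderiv ℝ η t‖ ≤ M := by
  set η : ℝ → ℝ := fun t => Real.smoothTransition (2 - 2 * t) with hη
  have hηs : ContDiff ℝ ∞ η :=
    Real.smoothTransition.contDiff.comp (contDiff_const.sub (contDiff_const.mul contDiff_id))
  have hη1 : ∀ t, t ≤ 1 / 2 → η t = 1 := fun t ht =>
    Real.smoothTransition.one_of_one_le (by linarith)
  have hη0 : ∀ t, 1 ≤ t → η t = 0 := fun t ht =>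
    Real.smoothTransition.zero_of_nonpos (by linarith)
  refine ⟨η, hηs, fun t => ⟨Real.smoothTransition.nonneg _, Real.smoothTransition.le_one _⟩,
    hη1, hη0, ?_⟩
  -- the derivative is continuous, and vanishes off `[0, 2]` where `η` is locally constant
  have hc : Continuous (fderiv ℝ η) := hηs.continuous_fderiv (by simp)
  obtain ⟨M, hM⟩ := (isCompact_Icc (a := (0 : ℝ)) (b := 2)).exists_bound_of_continuousOn
    hc.continuousOn
  refine ⟨max M 0, le_max_right _ _, fun t => ?_⟩
  by_cases ht : t ∈ Icc (0 : ℝ) 2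
  · exact (hM t ht).trans (le_max_left _ _)
  · have hzero : fderiv ℝ η t = 0 := by
      rw [mem_Icc, not_and_or, not_le, not_le] at ht
      rcases ht with ht | ht
      · have : η =ᶠ[𝓝 t] fun _ => 1 := by
          filter_upwards [Iio_mem_nhds (show t < 1 / 2 by linarith)] with s hs
          exact hη1 s (le_of_lt hs)
        rw [this.fderiv_eq, fderiv_const_apply]
      · have : η =ᶠ[𝓝 t] fun _ => 0 := by
          filter_upwards [Ioi_mem_nhds (show 1 < t by linarith)] with s hs
          exact hη0 s (le_of_lt hs)
        rw [this.fderiv_eq, fderiv_const_apply]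
    rw [hzero, norm_zero]
    exact le_max_right _ _

end Profile

/-! ### Mollified Lipschitz functions -/

section Mollify

variable {E' : Type*} [NormedAddCommGroup E'] [NormedSpace ℝ E'] [FiniteDimensional ℝ E']
  [MeasurableSpace E'] [BorelSpace E']

/-- **Smoothing a Lipschitz function**: for `θ` `K`-Lipschitz and `ε > 0` there is a smooth `θ'`
with `|θ' - θ| ≤ K ε` and `‖Dθ'‖ ≤ K` everywhere — the mollification `ρ_ε ⋆ θ`, which is again
`K`-Lipschitz (Evans–Gariepy, §4.2, Theorem 1, proof; standard). [folklore] -/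
theorem exists_smooth_near_lipschitz {θ : E' → ℝ} {K : ℝ≥0} (hθ : LipschitzWith K θ)
    (μ : Measure E') [μ.IsAddHaarMeasure] {ε : ℝ} (hε : 0 < ε) :
    ∃ θ' : E' → ℝ, ContDiff ℝ ∞ θ' ∧ (∀ y, |θ' y - θ y| ≤ K * ε) ∧
      ∀ y, ‖fderiv ℝ θ' y‖ ≤ K := by
  let φ : ContDiffBump (0 : E') := ⟨ε / 2, ε, half_pos hε, half_lt_self hε⟩
  set θ' : E' → ℝ := φ.normed μ ⋆[ContinuousLinearMap.lsmul ℝ ℝ, μ] θ with hθ'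
  have hθc : Continuous θ := hθ.continuous
  refine ⟨θ', ?_, fun y => ?_, fun y => ?_⟩
  · exact φ.hasCompactSupport_normed.contDiff_convolution_left _ φ.contDiff_normed
      (hθc.locallyIntegrable (μ := μ))
  · have h := φ.dist_normed_convolution_le (μ := μ) hθc.aestronglyMeasurable (x₀ := y)
      (ε := K * ε) fun x hx => (hθ.dist_le_mul x y).trans
        (mul_le_mul_of_nonneg_left (le_of_lt (mem_ball.1 hx)) K.coe_nonneg)
    rwa [Real.dist_eq] at h
  · -- `θ'` is `K`-Lipschitz
    have hlip : LipschitzWith K θ' := by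
      refine LipschitzWith.of_dist_le_mul fun x x' => ?_
      have hint : ∀ z : E', Integrable (fun t => φ.normed μ t • θ (z - t)) μ := fun z =>
        (φ.continuous_normed.smul (hθc.comp (continuous_const.sub continuous_id))).integrable_of_hasCompactSupport
          φ.hasCompactSupport_normed.smul_right
      have hx : θ' x = ∫ t, φ.normed μ t • θ (x - t) ∂μ := by
        rw [hθ', convolution_def]; rfl
      have hx' : θ' x' = ∫ t, φ.normed μ t • θ (x' - t) ∂μ := by
        rw [hθ', convolution_def]; rfl
      rw [Real.dist_eq, hx, hx', ← integral_sub (hint x) (hint x')]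
      have hbound : ∀ t, ‖φ.normed μ t • θ (x - t) - φ.normed μ t • θ (x' - t)‖ ≤
          φ.normed μ t * (K * dist x x') := fun t => by
        rw [← smul_sub, norm_smul, Real.norm_of_nonneg (φ.nonneg_normed t)]
        refine mul_le_mul_of_nonneg_left ?_ (φ.nonneg_normed t)
        have := hθ.dist_le_mul (x - t) (x' - t)
        rwa [dist_sub_right, Real.dist_eq, ← Real.norm_eq_abs] at this
      calc |∫ t, φ.normed μ t • θ (x - t) - φ.normed μ t • θ (x' - t) ∂μ|
          ≤ ∫ t, φ.normed μ t * (K * dist x x') ∂μ := by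
            rw [← Real.norm_eq_abs]
            exact norm_integral_le_of_norm_le (φ.integrable_normed.mul_const _)
              (Eventually.of_forall hbound)
        _ = K * dist x x' := by rw [integral_mul_const, φ.integral_normed, one_mul]
    exact norm_fderiv_le_of_lipschitz ℝ hlip

end Mollify

/-! ### Smooth cut-offs adapted to a Lipschitz graph -/

section Cutoff

variable {E' : Type*} [NormedAddCommGroup E'] [InnerProductSpace ℝ E'] [FiniteDimensional ℝ E']
  [MeasurableSpace E'] [BorelSpace E']

/-- **Smooth cut-offs along a Lipschitz graph.** Let `u` be a unit vector and `θ : E' → ℝ`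
`K`-Lipschitz (the graph function composed with the projection onto `uᗮ`), and write
`h(y) = ⟪y, u⟫ - θ y` for the height above the graph. There is `C = C(K)` such that for every
`τ > 0` there is a smooth `ζ : E' → [0, 1]` with `ζ = 1` where `h ≤ τ/8`, `ζ = 0` where
`h ≥ 3τ/4`,
and `‖Dζ‖ ≤ C / τ`. This is the cut-off `ζ(m x_n)` of Evans, *PDE* (2010), §5.5, proof of
Theorem 2, transplanted from the flat to the Lipschitz-graph picture by replacing the height
`x_n` with a mollified height `⟪y, u⟫ - (ρ_ε ⋆ θ)(y)`, `K ε ≤ τ/8` (`exists_smooth_near_lipschitz`),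
composed with a fixed smooth profile (`exists_smooth_profile`). [folklore] -/
theorem exists_smooth_cutoff {u : E'} (hu : ‖u‖ = 1) {θ : E' → ℝ} {K : ℝ≥0}
    (hθ : LipschitzWith K θ) (μ : Measure E') [μ.IsAddHaarMeasure] :
    ∃ C : ℝ, 0 ≤ C ∧ ∀ τ : ℝ, 0 < τ → ∃ ζ : E' → ℝ, ContDiff ℝ ∞ ζ ∧
      (∀ y, ζ y ∈ Icc (0 : ℝ) 1) ∧ (∀ y, ⟪y, u⟫_ℝ - θ y ≤ τ / 8 → ζ y = 1) ∧
      (∀ y, 3 * τ / 4 ≤ ⟪y, u⟫_ℝ - θ y → ζ y = 0) ∧ ∀ y, ‖fderiv ℝ ζ y‖ ≤ C / τ := by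
  obtain ⟨η, hηs, hη01, hη1, hη0, M, hM0, hM⟩ := exists_smooth_profile
  refine ⟨2 * M * (1 + K), by positivity, fun τ hτ => ?_⟩
  -- smooth the height function at scale `ε` with `K ε ≤ τ / 8`
  obtain ⟨θ', hθ's, hθ'near, hθ'D⟩ :=
    exists_smooth_near_lipschitz hθ μ (ε := τ / (8 * (K + 1))) (by positivity)
  have hnear : ∀ y, |θ' y - θ y| ≤ τ / 8 := fun y => (hθ'near y).trans <| by
    calc (K : ℝ) * (τ / (8 * (K + 1))) ≤ (K + 1) * (τ / (8 * (K + 1))) := by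
          gcongr; linarith
      _ = τ / 8 := by field_simp
  -- the smoothed height and the cut-off
  set L : E' →L[ℝ] ℝ := innerSL ℝ u with hL
  have hLy : ∀ y, L y = ⟪y, u⟫_ℝ := fun y => by rw [hL, innerSL_apply_apply, real_inner_comm]
  have hLnorm : ‖L‖ = 1 := by rw [hL, innerSL_apply_norm, hu]
  set hgt : E' → ℝ := fun y => L y - θ' y with hhgt_def
  have hhgt : ∀ y, |hgt y - (⟪y, u⟫_ℝ - θ y)| ≤ τ / 8 := fun y => by
    have : hgt y - (⟪y, u⟫_ℝ - θ y) = -(θ' y - θ y) := by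
      simp only [hhgt_def, hLy]; ring
    rw [this, abs_neg]
    exact hnear y
  set ζ : E' → ℝ := fun y => η (2 / τ * hgt y) with hζ_def
  have h2τ : 0 < 2 / τ := by positivity
  have hθ'd : Differentiable ℝ θ' := hθ's.differentiable (by simp)
  have hprofd : Differentiable ℝ η := hηs.differentiable (by simp)
  refine ⟨ζ, ?_, fun y => hη01 _, fun y hy => ?_, fun y hy => ?_, fun y => ?_⟩
  · exact hηs.comp (contDiff_const.mul (L.contDiff.sub hθ's))
  · -- `h ≤ τ/8` gives `hgt ≤ τ/4`, argument `≤ 1/2`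
    refine hη1 _ ?_
    have h1 : hgt y ≤ τ / 4 := by
      have := (abs_le.1 (hhgt y)).2
      linarith
    calc 2 / τ * hgt y ≤ 2 / τ * (τ / 4) := mul_le_mul_of_nonneg_left h1 h2τ.le
      _ = 1 / 2 := by field_simp; ring
  · -- if `h ≥ 3τ/4` then `hgt ≥ 5τ/8`, argument `≥ 1`, `ζ = 0`
    refine hη0 _ ?_
    have h1 : 5 * τ / 8 ≤ hgt y := by
      have := (abs_le.1 (hhgt y)).1
      linarith
    calc (1 : ℝ) ≤ 2 / τ * (5 * τ / 8) := by
          rw [show 2 / τ * (5 * τ / 8) = (5 / 4 : ℝ) by field_simp; ring]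
          norm_num
      _ ≤ 2 / τ * hgt y := mul_le_mul_of_nonneg_left h1 h2τ.le
  · -- chain rule
    have hhgt' : HasFDerivAt hgt (L - fderiv ℝ θ' y) y :=
      L.hasFDerivAt.sub (hθ'd y).hasFDerivAt
    have harg : HasFDerivAt (fun y => 2 / τ * hgt y) ((2 / τ) • (L - fderiv ℝ θ' y)) y :=
      hhgt'.const_mul (2 / τ)
    have hcomp : HasFDerivAt ζ ((fderiv ℝ η (2 / τ * hgt y)).comp
        ((2 / τ) • (L - fderiv ℝ θ' y))) y :=
      (hprofd _).hasFDerivAt.comp y harg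
    rw [hcomp.fderiv]
    calc ‖(fderiv ℝ η (2 / τ * hgt y)).comp ((2 / τ) • (L - fderiv ℝ θ' y))‖
        ≤ ‖fderiv ℝ η (2 / τ * hgt y)‖ * ‖(2 / τ) • (L - fderiv ℝ θ' y)‖ :=
          ContinuousLinearMap.opNorm_comp_le _ _
      _ ≤ M * (2 / τ * (1 + K)) := by
          refine mul_le_mul (hM _) ?_ (norm_nonneg _) hM0
          rw [norm_smul, Real.norm_of_nonneg h2τ.le]
          refine mul_le_mul_of_nonneg_left ?_ h2τ.le
          calc ‖L - fderiv ℝ θ' y‖ ≤ ‖L‖ + ‖fderiv ℝ θ' y‖ := norm_sub_le _ _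
            _ ≤ 1 + K := by rw [hLnorm]; exact add_le_add le_rfl (hθ'D y)
      _ = 2 * M * (1 + K) / τ := by field_simp

end Cutoff


/-! ### Localisation lemmas (no inner product needed) -/

section Localise

open LipGraph

variable {E' : Type*} [NormedAddCommGroup E'] [NormedSpace ℝ E'] [FiniteDimensional ℝ E']
  [MeasurableSpace E'] [BorelSpace E']
variable {F : Type*} [NormedAddCommGroup F] [NormedSpace ℝ F]

omit [NormedSpace ℝ E'] [FiniteDimensional ℝ E'] [MeasurableSpace E'] [BorelSpace E'] [NormedSpace ℝ F] in
/-- **Continuity of the `L^p` norm along `L^p` convergence**: if `‖g - fₙ‖_p → 0` then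
`‖fₙ‖_p → ‖g‖_p` (reverse triangle inequality). [folklore] -/
theorem tendsto_eLpNorm_of_tendsto_eLpNorm_sub {X : Type*} [MeasurableSpace X] {ν : Measure X}
    {p : ℝ≥0∞} (hp : 1 ≤ p) {f : ℕ → X → F} {g : X → F}
    (hf : ∀ n, AEStronglyMeasurable (f n) ν) (hg : AEStronglyMeasurable g ν)
    (h : Tendsto (fun n => eLpNorm (g - f n) p ν) atTop (𝓝 0)) :
    Tendsto (fun n => eLpNorm (f n) p ν) atTop (𝓝 (eLpNorm g p ν)) := by
  have hup : ∀ n, eLpNorm (f n) p ν ≤ eLpNorm g p ν + eLpNorm (g - f n) p ν := fun n => by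
    calc eLpNorm (f n) p ν = eLpNorm (g - (g - f n)) p ν := by
          congr 1; exact (sub_sub_cancel g (f n)).symm
      _ ≤ eLpNorm g p ν + eLpNorm (g - f n) p ν := eLpNorm_sub_le hg (hg.sub (hf n)) hp
  have hlow : ∀ n, eLpNorm g p ν - eLpNorm (g - f n) p ν ≤ eLpNorm (f n) p ν := fun n => by
    refine tsub_le_iff_right.2 ?_
    calc eLpNorm g p ν = eLpNorm (f n + (g - f n)) p ν := by rw [add_sub_cancel]
      _ ≤ eLpNorm (f n) p ν + eLpNorm (g - f n) p ν := eLpNorm_add_le (hf n) (hg.sub (hf n)) hp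
  have h1 : Tendsto (fun n => eLpNorm g p ν + eLpNorm (g - f n) p ν) atTop
      (𝓝 (eLpNorm g p ν)) := by
    simpa using tendsto_const_nhds.add h
  have h2 : Tendsto (fun n => eLpNorm g p ν - eLpNorm (g - f n) p ν) atTop
      (𝓝 (eLpNorm g p ν)) := by
    simpa using ENNReal.Tendsto.sub tendsto_const_nhds h (Or.inr ENNReal.zero_ne_top)
  exact tendsto_of_tendsto_of_tendsto_of_le_of_le h2 h1 hlow hup

omit [NormedSpace ℝ E'] [FiniteDimensional ℝ E'] [MeasurableSpace E'] [BorelSpace E'] in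
/-- `∫ ‖f‖^q = ‖f‖_p^q`, `q = p.toReal`, for `0 < p < ∞`. [folklore] -/
theorem lintegral_enorm_rpow_eq_eLpNorm_rpow {X : Type*} [MeasurableSpace X] {ν : Measure X}
    {G : Type*} [NormedAddCommGroup G] {p : ℝ≥0∞} (hp0 : p ≠ 0) (hp' : p ≠ ⊤) (f : X → G) :
    ∫⁻ x, ‖f x‖ₑ ^ p.toReal ∂ν = eLpNorm f p ν ^ p.toReal := by
  have hq : 0 < p.toReal := ENNReal.toReal_pos hp0 hp'
  rw [eLpNorm_eq_lintegral_rpow_enorm_toReal hp0 hp', ← ENNReal.rpow_mul,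
    one_div_mul_cancel hq.ne', ENNReal.rpow_one]

/-- **`C¹` approximants in `W^{1,p}(Ω)` have `L^p`-convergent derivatives**: if `φₖ ∈ C¹(E')`
and `‖f - φₖ‖_{W^{1,p}(Ω)} → 0`, then `‖g - Dφₖ‖_{L^p(Ω)} → 0` for any weak derivative `g` of `f`
(variant of `Literature.Analysis.FunctionSpaces.tendsto_eLpNorm_fderiv_of_tendsto_eSobolevDomainNorm` of
`SobolevDomainGNSProofs`, which is stated for test functions `φₖ`; the proof only uses that
classical derivatives of `C¹` functions are weak derivatives and the a.e. uniqueness of weak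
derivatives) (Evans, *PDE*, §5.2.1–5.2.2). [folklore] -/
theorem tendsto_eLpNorm_fderiv_sub_of_contDiff [CompleteSpace F] {p : ℝ≥0∞} (hp : 1 ≤ p)
    {Ω : Opens E'} {μ : Measure E'} [μ.IsAddHaarMeasure] {f : E' → F} {g : E' → E' →L[ℝ] F}
    (hfg : HasWeakFDerivOn Ω μ f g) {φ : ℕ → E' → F} (hφ : ∀ k, ContDiff ℝ 1 (φ k))
    (hlim : Tendsto (fun k => eSobolevDomainNorm 1 p Ω μ (f - φ k)) atTop (𝓝 0)) :
    Tendsto (fun k => eLpNorm (fun x => g x - fderiv ℝ (φ k) x) p (μ.restrict Ω)) atTop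
      (𝓝 0) := by
  set b := Module.finBasis ℝ E'
  set Cb : ℝ≥0 := Fintype.card (Fin (finrank ℝ E')) •
    ‖(b.equivFunL : E' →L[ℝ] Fin (finrank ℝ E') → ℝ)‖₊
  set I : ℕ → ℝ≥0∞ := fun k => ⨅ (g' : E' → E' →L[ℝ] F) (_ : HasWeakFDerivOn Ω μ (f - φ k) g'),
    ∑ i, eLpNorm (fun x => g' x (b i)) p (μ.restrict Ω) with hI_def
  have hI : Tendsto I atTop (𝓝 0) := by
    refine tendsto_of_tendsto_of_tendsto_of_le_of_le tendsto_const_nhds hlim (fun _ => zero_le)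
      fun k => ?_
    exact le_add_self
  have hkey : ∀ k, eLpNorm (fun x => g x - fderiv ℝ (φ k) x) p (μ.restrict Ω) ≤ Cb * I k := by
    intro k
    have hφk : HasWeakFDerivOn Ω μ (φ k) (fderiv ℝ (φ k)) :=
      HasWeakFDerivOn.of_contDiff_holds Ω μ (hφ k)
    have hd : HasWeakFDerivOn Ω μ (f - φ k) (g - fderiv ℝ (φ k)) := hfg.sub hφk
    have h1 : ∀ g', HasWeakFDerivOn Ω μ (f - φ k) g' →
        eLpNorm (fun x => g x - fderiv ℝ (φ k) x) p (μ.restrict Ω) ≤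
          Cb * ∑ i, eLpNorm (fun x => g' x (b i)) p (μ.restrict Ω) := by
      intro g' hg'
      have hae : g' =ᵐ[μ.restrict Ω] (g - fderiv ℝ (φ k)) := HasWeakFDerivOn.unique_holds hg' hd
      calc eLpNorm (fun x => g x - fderiv ℝ (φ k) x) p (μ.restrict Ω)
          = eLpNorm g' p (μ.restrict Ω) := (eLpNorm_congr_ae hae).symm
        _ ≤ Cb * ∑ i, eLpNorm (fun x => g' x (b i)) p (μ.restrict Ω) :=
          SobolevApprox.eLpNorm_le_mul_sum_eLpNorm_apply_basis b
            hg'.locallyIntegrableOn_deriv.aestronglyMeasurable hp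
    calc eLpNorm (fun x => g x - fderiv ℝ (φ k) x) p (μ.restrict Ω)
        ≤ ⨅ (g' : E' → E' →L[ℝ] F) (_ : HasWeakFDerivOn Ω μ (f - φ k) g'),
            Cb * ∑ i, eLpNorm (fun x => g' x (b i)) p (μ.restrict Ω) := le_iInf₂ h1
      _ ≤ Cb * I k := by
        simp only [hI_def]
        rcases eq_or_ne (Cb : ℝ≥0∞) 0 with h0 | h0
        · refine (iInf₂_le (g - fderiv ℝ (φ k)) hd).trans ?_
          simp [h0]
        rw [ENNReal.mul_iInf_of_ne h0 ENNReal.coe_ne_top]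
        refine le_iInf fun g' => ?_
        rw [ENNReal.mul_iInf_of_ne h0 ENNReal.coe_ne_top]
        exact le_iInf fun hg' => iInf₂_le g' hg'
  have hCI : Tendsto (fun k => (Cb : ℝ≥0∞) * I k) atTop (𝓝 0) := by
    simpa using ENNReal.Tendsto.const_mul hI (Or.inr ENNReal.coe_ne_top)
  exact tendsto_of_tendsto_of_tendsto_of_le_of_le tendsto_const_nhds hCI (fun _ => zero_le) hkey


omit [FiniteDimensional ℝ E'] [MeasurableSpace E'] [BorelSpace E'] in
/-- `smulRight` is additive in the vector: `A ⊗ (v - w) = A ⊗ v - A ⊗ w`. [folklore] -/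
theorem smulRight_sub (A : E' →L[ℝ] ℝ) (v w : F) :
    A.smulRight (v - w) = A.smulRight v - A.smulRight w := by
  ext x
  simp [smul_sub]

omit [NormedAddCommGroup E'] [NormedSpace ℝ E'] [FiniteDimensional ℝ E'] [MeasurableSpace E']
  [BorelSpace E'] in
/-- `L^p` convergence is preserved under multiplication by a bounded function:
`‖ρ (f - φₙ)‖_p ≤ C ‖f - φₙ‖_p → 0`. [folklore] -/
theorem tendsto_eLpNorm_smul_of_tendsto {X : Type*} [MeasurableSpace X] {ν : Measure X}
    {p : ℝ≥0∞} {h : ℕ → X → F} (hh : Tendsto (fun n => eLpNorm (h n) p ν) atTop (𝓝 0))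
    {ρ : X → ℝ} {C : ℝ} (hC : ∀ x, ‖ρ x‖ ≤ C) :
    Tendsto (fun n => eLpNorm (fun x => ρ x • h n x) p ν) atTop (𝓝 0) := by
  refine tendsto_of_tendsto_of_tendsto_of_le_of_le tendsto_const_nhds ?_ (fun _ => zero_le)
    fun n => eLpNorm_smul_le_of_bound hC (h n)
  simpa using ENNReal.Tendsto.const_mul hh (Or.inr ENNReal.ofReal_ne_top)

omit [NormedSpace ℝ E'] [FiniteDimensional ℝ E'] [MeasurableSpace E'] [BorelSpace E']
  [NormedSpace ℝ F] in
/-- **Absolute continuity of `‖G‖_{L^p}` on shrinking sets**: for `G ∈ L^p(ν)`, `p < ∞`, and a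
decreasing sequence of measurable sets with empty intersection and finite measure,
`‖G‖_{L^p(S_m)} → 0`. [folklore] -/
theorem tendsto_eLpNorm_restrict_of_antitone {X : Type*} [MeasurableSpace X] {ν : Measure X}
    {p : ℝ≥0∞} (hp0 : p ≠ 0) (hp' : p ≠ ⊤) {G : X → F} (hG : MemLp G p ν) {S : ℕ → Set X}
    (hSm : ∀ m, MeasurableSet (S m)) (hanti : Antitone S) (hinter : ⋂ m, S m = ∅)
    (hfin : ν (S 0) ≠ ⊤) :
    Tendsto (fun m => eLpNorm G p (ν.restrict (S m))) atTop (𝓝 0) := by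
  have hq0 : 0 < p.toReal := ENNReal.toReal_pos hp0 hp'
  have hνS : Tendsto (ν ∘ S) atTop (𝓝 0) := by
    have := tendsto_measure_iInter_atTop (μ := ν) (fun m => (hSm m).nullMeasurableSet) hanti
      ⟨0, hfin⟩
    rwa [hinter, measure_empty] at this
  have hfinI : ∫⁻ y, ‖G y‖ₑ ^ p.toReal ∂ν ≠ ⊤ := by
    rw [lintegral_enorm_rpow_eq_eLpNorm_rpow hp0 hp']
    exact ENNReal.rpow_ne_top_of_nonneg hq0.le hG.eLpNorm_ne_top
  have hint := tendsto_setLIntegral_zero hfinI hνS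
  have := ((ENNReal.continuous_rpow_const (y := 1 / p.toReal)).tendsto 0).comp hint
  rw [ENNReal.zero_rpow_of_pos (by positivity)] at this
  refine this.congr fun m => ?_
  rw [Function.comp_apply, eLpNorm_eq_lintegral_rpow_enorm_toReal hp0 hp']

section Complete

variable [CompleteSpace F]

/-- **Localised `C¹` approximants, derivatives**: if `φₙ → f` in `W^{1,p}(Ω)` with
`φₙ ∈ C¹`, then for `ρ ∈ C_c^∞`, `D(ρ φₙ) → ρ Df + Dρ ⊗ f` in `L^p(Ω)` for the weak derivative
`Df` of `f` (product rule; Evans, *PDE*, §5.5, proof of Theorem 2, first reduction). [folklore] -/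
theorem tendsto_eLpNorm_deriv_smul_sub {Ω : Opens E'} (μ : Measure E') [μ.IsAddHaarMeasure]
    {p : ℝ≥0∞} (hp : 1 ≤ p) {f : E' → F} {Df : E' → E' →L[ℝ] F} (hf0 : MemLp f p (μ.restrict Ω))
    (hDf : HasWeakFDerivOn Ω μ f Df) {φ : ℕ → E' → F} (hφ : ∀ n, ContDiff ℝ 1 (φ n))
    (hφf : Tendsto (fun n => eSobolevDomainNorm 1 p Ω μ (f - φ n)) atTop (𝓝 0)) {ρ : E' → ℝ}
    (hρ : ContDiff ℝ ∞ ρ) (hρc : HasCompactSupport ρ) :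
    Tendsto (fun n => eLpNorm (fun x => (ρ x • Df x + (fderiv ℝ ρ x).smulRight (f x)) -
      fderiv ℝ (fun x => ρ x • φ n x) x) p (μ.restrict Ω)) atTop (𝓝 0) := by
  obtain ⟨C₀, hC₀⟩ := hρ.continuous.bounded_above_of_compact_support hρc
  obtain ⟨C₁, hC₁⟩ := (hρ.continuous_fderiv (by simp)).bounded_above_of_compact_support
    (hρc.fderiv ℝ)
  have hρ1 : ContDiff ℝ 1 ρ := hρ.of_le (by simp)
  have hfφ : Tendsto (fun n => eLpNorm (f - φ n) p (μ.restrict Ω)) atTop (𝓝 0) :=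
    tendsto_of_tendsto_of_tendsto_of_le_of_le tendsto_const_nhds hφf (fun _ => zero_le)
      fun _ => eLpNorm_le_eSobolevDomainNorm
  have hDfφ : Tendsto (fun n => eLpNorm (fun x => Df x - fderiv ℝ (φ n) x) p (μ.restrict Ω))
      atTop (𝓝 0) :=
    tendsto_eLpNorm_fderiv_sub_of_contDiff hp hDf hφ hφf
  -- the pointwise identity `(ρ Df + Dρ ⊗ f) - D(ρ φₙ) = ρ (Df - Dφₙ) + Dρ ⊗ (f - φₙ)`
  have hpt : ∀ n x, (ρ x • Df x + (fderiv ℝ ρ x).smulRight (f x)) -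
      fderiv ℝ (fun x => ρ x • φ n x) x =
      ρ x • (Df x - fderiv ℝ (φ n) x) + (fderiv ℝ ρ x).smulRight ((f - φ n) x) := by
    intro n x
    have hd : fderiv ℝ (fun x => ρ x • φ n x) x =
        ρ x • fderiv ℝ (φ n) x + (fderiv ℝ ρ x).smulRight (φ n x) :=
      fderiv_smul (hρ1.differentiable one_ne_zero x) ((hφ n).differentiable one_ne_zero x)
    rw [hd, add_sub_add_comm, ← smul_sub, ← smulRight_sub, Pi.sub_apply]
  have hle : ∀ n, eLpNorm (fun x => (ρ x • Df x + (fderiv ℝ ρ x).smulRight (f x)) -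
      fderiv ℝ (fun x => ρ x • φ n x) x) p (μ.restrict Ω) ≤
      ENNReal.ofReal C₀ * eLpNorm (fun x => Df x - fderiv ℝ (φ n) x) p (μ.restrict Ω) +
        ENNReal.ofReal C₁ * eLpNorm (f - φ n) p (μ.restrict Ω) := by
    intro n
    have hm1 : AEStronglyMeasurable (fun x => ρ x • (Df x - fderiv ℝ (φ n) x)) (μ.restrict Ω) :=
      hρ.continuous.aestronglyMeasurable.smul
        (hDf.locallyIntegrableOn_deriv.aestronglyMeasurable.sub
          ((hφ n).continuous_fderiv one_ne_zero).aestronglyMeasurable)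
    have hm2 : AEStronglyMeasurable (fun x => (fderiv ℝ ρ x).smulRight ((f - φ n) x))
        (μ.restrict Ω) :=
      isBoundedBilinearMap_smulRight.continuous.comp_aestronglyMeasurable₂
        (hρ.continuous_fderiv (by simp)).aestronglyMeasurable
        (hf0.aestronglyMeasurable.sub (hφ n).continuous.aestronglyMeasurable)
    calc eLpNorm (fun x => (ρ x • Df x + (fderiv ℝ ρ x).smulRight (f x)) -
          fderiv ℝ (fun x => ρ x • φ n x) x) p (μ.restrict Ω)
        = eLpNorm ((fun x => ρ x • (Df x - fderiv ℝ (φ n) x)) +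
            fun x => (fderiv ℝ ρ x).smulRight ((f - φ n) x)) p (μ.restrict Ω) :=
          eLpNorm_congr_ae (Eventually.of_forall fun x => hpt n x)
      _ ≤ eLpNorm (fun x => ρ x • (Df x - fderiv ℝ (φ n) x)) p (μ.restrict Ω) +
            eLpNorm (fun x => (fderiv ℝ ρ x).smulRight ((f - φ n) x)) p (μ.restrict Ω) :=
          eLpNorm_add_le (ε := E' →L[ℝ] F) hm1 hm2 hp
      _ ≤ _ := by
          refine add_le_add
            (eLpNorm_smul_le_of_bound hC₀ (fun x => Df x - fderiv ℝ (φ n) x)) ?_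
          refine eLpNorm_le_mul_eLpNorm_of_ae_le_mul (Eventually.of_forall fun x => ?_) p
          rw [ContinuousLinearMap.norm_smulRight_apply]
          exact mul_le_mul_of_nonneg_right (hC₁ x) (norm_nonneg _)
  refine tendsto_of_tendsto_of_tendsto_of_le_of_le tendsto_const_nhds ?_ (fun _ => zero_le) hle
  simpa using (ENNReal.Tendsto.const_mul hDfφ (Or.inr ENNReal.ofReal_ne_top)).add
    (ENNReal.Tendsto.const_mul hfφ (Or.inr ENNReal.ofReal_ne_top))

end Complete

omit [NormedAddCommGroup E'] [NormedSpace ℝ E'] [FiniteDimensional ℝ E'] [MeasurableSpace E']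
  [BorelSpace E'] [NormedAddCommGroup F] [NormedSpace ℝ F] in
/-- `‖𝟙_S w‖_{L^p(T)} = ‖w‖_{L^p(S)}` for measurable `S ⊆ T`. [folklore] -/
theorem eLpNorm_indicator_restrict_eq {X : Type*} [MeasurableSpace X] {ν : Measure X}
    {H : Type*} [NormedAddCommGroup H] {S T : Set X} (hSm : MeasurableSet S) (hST : S ⊆ T)
    (w : X → H) (p : ℝ≥0∞) :
    eLpNorm (S.indicator w) p (ν.restrict T) = eLpNorm w p (ν.restrict S) := by
  rw [eLpNorm_indicator_eq_eLpNorm_restrict hSm, Measure.restrict_restrict hSm,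
    inter_eq_left.2 hST]

/-- **`W^{1,p}` bound for a cut-off product localised in a strip**: if `g` has weak derivative
`G` on `Ω`, `g` and `G` vanish off `T`, `ζ` is smooth with `|ζ| ≤ 1`, `‖Dζ‖ ≤ D`, and on `Ω ∩ T`
the points where `ζ ≠ 0` or `Dζ ≠ 0` lie in the measurable set `S ⊆ Ω`, then
`‖ζ g‖_{W^{1,p}(Ω)} ≤ ‖g‖_{L^p(S)} + Σᵢ (‖eᵢ‖ ‖G‖_{L^p(S)} + D ‖eᵢ‖ ‖g‖_{L^p(S)})`
(product rule `D(ζ g) = ζ G + Dζ ⊗ g`, Evans, *PDE*, §5.5, proof of Theorem 2, the terms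
`A` and `B`). [folklore] -/
theorem eSobolevDomainNorm_cutoff_smul_le {Ω : Opens E'} {μ : Measure E'} {p : ℝ≥0∞} (hp : 1 ≤ p)
    {g : E' → F} {G : E' → E' →L[ℝ] F} (hG : HasWeakFDerivOn Ω μ g G) {T S : Set E'}
    (hgT : ∀ y, y ∉ T → g y = 0) (hGT : ∀ y, y ∉ T → G y = 0) (hSm : MeasurableSet S)
    (hSΩ : S ⊆ (Ω : Set E')) {ζ : E' → ℝ} (hζ : ContDiff ℝ ∞ ζ) (hζ1 : ∀ y, |ζ y| ≤ 1) {D : ℝ}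
    (hζD : ∀ y, ‖fderiv ℝ ζ y‖ ≤ D)
    (hζS : ∀ y ∈ (Ω : Set E'), y ∈ T → ζ y ≠ 0 → y ∈ S)
    (hDζS : ∀ y ∈ (Ω : Set E'), y ∈ T → fderiv ℝ ζ y ≠ 0 → y ∈ S) :
    eSobolevDomainNorm 1 p Ω μ (fun x => ζ x • g x) ≤
      eLpNorm g p (μ.restrict S) + ∑ i, (ENNReal.ofReal ‖Module.finBasis ℝ E' i‖ *
        eLpNorm G p (μ.restrict S) +
        ENNReal.ofReal (D * ‖Module.finBasis ℝ E' i‖) * eLpNorm g p (μ.restrict S)) := by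
  have hΩm : MeasurableSet (Ω : Set E') := Ω.isOpen.measurableSet
  set b := Module.finBasis ℝ E'
  have hW : HasWeakFDerivOn Ω μ (fun x => ζ x • g x)
      (fun x => ζ x • G x + (fderiv ℝ ζ x).smulRight (g x)) :=
    SobolevApprox.hasWeakFDerivOn_smul hG hζ
  -- pointwise localisation on `Ω`
  have hloc1 : ∀ y ∈ (Ω : Set E'), ‖ζ y • g y‖ ≤ ‖S.indicator g y‖ := by
    intro y hyΩ
    by_cases hζy : ζ y = 0
    · simp [hζy]
    by_cases hyT : y ∈ T
    · rw [indicator_of_mem (hζS y hyΩ hyT hζy), norm_smul, Real.norm_eq_abs]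
      exact (mul_le_mul_of_nonneg_right (hζ1 y) (norm_nonneg _)).trans (by rw [one_mul])
    · simp [hgT y hyT]
  have hloc2 : ∀ v, ∀ y ∈ (Ω : Set E'), ‖ζ y • G y v‖ ≤ ‖v‖ * ‖S.indicator G y‖ := by
    intro v y hyΩ
    by_cases hζy : ζ y = 0
    · rw [hζy, zero_smul, norm_zero]; positivity
    by_cases hyT : y ∈ T
    · rw [indicator_of_mem (hζS y hyΩ hyT hζy), norm_smul, Real.norm_eq_abs]
      calc |ζ y| * ‖G y v‖ ≤ 1 * (‖G y‖ * ‖v‖) :=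
            mul_le_mul (hζ1 y) (ContinuousLinearMap.le_opNorm _ _) (norm_nonneg _) zero_le_one
        _ = ‖v‖ * ‖G y‖ := by ring
    · rw [hGT y hyT, _root_.zero_apply, smul_zero, norm_zero]; positivity
  have hloc3 : ∀ v, ∀ y ∈ (Ω : Set E'),
      ‖(fderiv ℝ ζ y v) • g y‖ ≤ (D * ‖v‖) * ‖S.indicator g y‖ := by
    intro v y hyΩ
    have hD0 : 0 ≤ D := (norm_nonneg _).trans (hζD y)
    by_cases hDy : fderiv ℝ ζ y = 0
    · rw [hDy, _root_.zero_apply, zero_smul, norm_zero]; positivity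
    by_cases hyT : y ∈ T
    · rw [indicator_of_mem (hDζS y hyΩ hyT hDy), norm_smul]
      refine mul_le_mul_of_nonneg_right ?_ (norm_nonneg _)
      exact (ContinuousLinearMap.le_opNorm _ _).trans
        (mul_le_mul_of_nonneg_right (hζD y) (norm_nonneg _))
    · rw [hgT y hyT, smul_zero, norm_zero]; positivity
  refine (SobolevApprox.eSobolevDomainNorm_one_le hW).trans (add_le_add ?_
    (Finset.sum_le_sum fun i _ => ?_))
  · calc eLpNorm (fun x => ζ x • g x) p (μ.restrict Ω)
        ≤ eLpNorm (S.indicator g) p (μ.restrict Ω) :=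
          eLpNorm_mono_ae (ae_restrict_of_forall_mem hΩm hloc1)
      _ = eLpNorm g p (μ.restrict S) := eLpNorm_indicator_restrict_eq hSm hSΩ g p
  · have heq : (fun x => (ζ x • G x + (fderiv ℝ ζ x).smulRight (g x)) (b i)) =
        (fun x => ζ x • G x (b i)) + fun x => (fderiv ℝ ζ x (b i)) • g x := by
      ext x
      simp [ContinuousLinearMap.smulRight_apply]
    rw [heq]
    refine (eLpNorm_add_le ?_ ?_ hp).trans (add_le_add ?_ ?_)
    · exact hζ.continuous.aestronglyMeasurable.smul
        (SobolevApprox.locallyIntegrableOn_deriv_apply hG _).aestronglyMeasurable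
    · exact ((hζ.continuous_fderiv (by simp)).clm_apply continuous_const).aestronglyMeasurable.smul
        hG.locallyIntegrableOn.aestronglyMeasurable
    · calc eLpNorm (fun x => ζ x • G x (b i)) p (μ.restrict Ω)
          ≤ ENNReal.ofReal ‖b i‖ * eLpNorm (S.indicator G) p (μ.restrict Ω) :=
            eLpNorm_le_mul_eLpNorm_of_ae_le_mul (ae_restrict_of_forall_mem hΩm (hloc2 (b i))) p
        _ = ENNReal.ofReal ‖b i‖ * eLpNorm G p (μ.restrict S) := by rw [eLpNorm_indicator_restrict_eq hSm hSΩ G p]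
    · calc eLpNorm (fun x => (fderiv ℝ ζ x (b i)) • g x) p (μ.restrict Ω)
          ≤ ENNReal.ofReal (D * ‖b i‖) * eLpNorm (S.indicator g) p (μ.restrict Ω) :=
            eLpNorm_le_mul_eLpNorm_of_ae_le_mul (ae_restrict_of_forall_mem hΩm (hloc3 (b i))) p
        _ = ENNReal.ofReal (D * ‖b i‖) * eLpNorm g p (μ.restrict S) := by rw [eLpNorm_indicator_restrict_eq hSm hSΩ g p]

end Localise

/-! ### Passing to the limit: the strip estimate for functions with vanishing trace -/

section StripLimit

open LipGraph

variable {E' : Type*} [NormedAddCommGroup E'] [InnerProductSpace ℝ E'] [FiniteDimensional ℝ E']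
  [MeasurableSpace E'] [BorelSpace E']
variable {F : Type*} [NormedAddCommGroup F] [NormedSpace ℝ F]
variable {u : E'} {γ : E' → ℝ} {Ω : Opens E'} {x₀ : E'} {r : ℝ}

/-- **Zero-trace strip estimate** (Evans, *PDE* (2010), §5.5, proof of Theorem 2, (10):
"`∫_{ℝ^{n-1}} |u(x', x_n)|^p dx' ≤ C x_n^{p-1} ∫₀^{x_n} ∫_{ℝ^{n-1}} |Du|^p dx' dt`", integrated
over `0 < x_n < τ`; Alt (2016), A8.10 with A8.9): in a chart of a Lipschitz domain, for
`ρ + τ ≤ r` and `1 ≤ p < ∞`, if `g ∈ L^p(Ω)` has weak derivative `G` on `Ω` and there are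
`φₙ ∈ C¹(E')` with `φₙ → g`, `Dφₙ → G` in `L^p(Ω)` and `‖φₙ‖_{L^p(∂Ω, μH[n-1])} → 0`, then
`∫_{strip ρ τ} ‖g‖^p dμ ≤ 2^{p-1} τ^p ∫_{strip ρ τ} ‖G‖^p dμ` (pass to the limit in
`sliceConst_mul_setLIntegral_strip_le_of_contDiff` and cancel the slicing constant).
[cite: Evans2010, §5.5 Theorem 2 (proof, estimate (10))] -/
theorem setLIntegral_strip_enorm_rpow_le [CompleteSpace F] (hu : ‖u‖ = 1)
    (hγc : Continuous γ)
    (hΩ : (Ω : Set E') ∩ ball x₀ r = {y | y ∈ ball x₀ r ∧ γ (y - ⟪y, u⟫_ℝ • u) < ⟪y, u⟫_ℝ})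
    (μ : Measure E') [μ.IsAddHaarMeasure] {ρ τ : ℝ} (hτ : 0 < τ) (hρ : ρ + τ ≤ r) {p : ℝ≥0∞}
    (hp : 1 ≤ p) (hp' : p ≠ ⊤) {g : E' → F} {G : E' → E' →L[ℝ] F}
    (hgp : MemLp g p (μ.restrict Ω)) (hG : HasWeakFDerivOn Ω μ g G) {φ : ℕ → E' → F}
    (hφ : ∀ n, ContDiff ℝ 1 (φ n))
    (hφg : Tendsto (fun n => eLpNorm (g - φ n) p (μ.restrict Ω)) atTop (𝓝 0))
    (hφG : Tendsto (fun n => eLpNorm (fun x => G x - fderiv ℝ (φ n) x) p (μ.restrict Ω)) atTop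
      (𝓝 0))
    (hφ0 : Tendsto (fun n => eLpNorm (φ n) p
      (μH[((finrank ℝ E' - 1 : ℕ) : ℝ)].restrict (frontier (Ω : Set E')))) atTop (𝓝 0)) :
    ∫⁻ y in strip u γ x₀ ρ τ, ‖g y‖ₑ ^ p.toReal ∂μ ≤
      2 ^ (p.toReal - 1) * ENNReal.ofReal τ ^ p.toReal *
        ∫⁻ y in strip u γ x₀ ρ τ, ‖G y‖ₑ ^ p.toReal ∂μ := by
  have hp0 : p ≠ 0 := (zero_lt_one.trans_le hp).ne'
  set q : ℝ := p.toReal with hq_def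
  have hq : 1 ≤ q := by
    have := (ENNReal.toReal_le_toReal ENNReal.one_ne_top hp').2 hp
    rwa [ENNReal.toReal_one] at this
  have hq0 : 0 < q := one_pos.trans_le hq
  set S : Set E' := strip u γ x₀ ρ τ with hS
  have hSΩ : S ⊆ (Ω : Set E') := fun y hy => (strip_subset hu hΩ hρ hy).1
  have hμS : μ.restrict S ≤ μ.restrict (Ω : Set E') := Measure.restrict_mono hSΩ le_rfl
  set c : ℝ≥0∞ := (sliceConst hu μ : ℝ≥0∞) with hc
  have hc0 : c ≠ 0 := by rw [hc]; exact_mod_cast (sliceConst_pos hu μ).ne'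
  have hct : c ≠ ⊤ := ENNReal.coe_ne_top
  set σ : Measure E' := μH[((finrank ℝ E' - 1 : ℕ) : ℝ)].restrict (frontier (Ω : Set E')) with hσ
  -- the `C¹` inequality along the approximants, in terms of `L^p` norms
  have hn : ∀ n, c * eLpNorm (φ n) p (μ.restrict S) ^ q ≤
      2 ^ (q - 1) * (ENNReal.ofReal τ * eLpNorm (φ n) p σ ^ q +
        ENNReal.ofReal τ ^ q * (c * eLpNorm (fderiv ℝ (φ n)) p (μ.restrict S) ^ q)) := by
    intro n
    have h := sliceConst_mul_setLIntegral_strip_le_of_contDiff hu Ω.isOpen hγc hΩ μ hτ hρ hq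
      (hφ n)
    rwa [lintegral_enorm_rpow_eq_eLpNorm_rpow hp0 hp', lintegral_enorm_rpow_eq_eLpNorm_rpow hp0 hp',
      ← hσ, lintegral_enorm_rpow_eq_eLpNorm_rpow hp0 hp'] at h
  -- the limits of the three norms
  have hpow : ∀ {a : ℕ → ℝ≥0∞} {A : ℝ≥0∞}, Tendsto a atTop (𝓝 A) →
      Tendsto (fun n => a n ^ q) atTop (𝓝 (A ^ q)) := fun h =>
    (ENNReal.continuous_rpow_const.tendsto _).comp h
  have hφm : ∀ n, AEStronglyMeasurable (φ n) (μ.restrict S) := fun n =>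
    (hφ n).continuous.aestronglyMeasurable
  have hDφm : ∀ n, AEStronglyMeasurable (fderiv ℝ (φ n)) (μ.restrict S) := fun n =>
    ((hφ n).continuous_fderiv one_ne_zero).aestronglyMeasurable
  have hlimg : Tendsto (fun n => eLpNorm (φ n) p (μ.restrict S)) atTop
      (𝓝 (eLpNorm g p (μ.restrict S))) := by
    refine tendsto_eLpNorm_of_tendsto_eLpNorm_sub hp hφm
      (hgp.aestronglyMeasurable.mono_measure hμS) ?_
    exact tendsto_of_tendsto_of_tendsto_of_le_of_le tendsto_const_nhds hφg (fun _ => zero_le)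
      fun n => eLpNorm_mono_measure _ hμS
  have hlimG : Tendsto (fun n => eLpNorm (fderiv ℝ (φ n)) p (μ.restrict S)) atTop
      (𝓝 (eLpNorm G p (μ.restrict S))) := by
    refine tendsto_eLpNorm_of_tendsto_eLpNorm_sub hp hDφm
      (hG.locallyIntegrableOn_deriv.aestronglyMeasurable.mono_measure hμS) ?_
    exact tendsto_of_tendsto_of_tendsto_of_le_of_le tendsto_const_nhds hφG (fun _ => zero_le)
      fun n => eLpNorm_mono_measure _ hμS
  have hL : Tendsto (fun n => c * eLpNorm (φ n) p (μ.restrict S) ^ q) atTop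
      (𝓝 (c * eLpNorm g p (μ.restrict S) ^ q)) :=
    ENNReal.Tendsto.const_mul (hpow hlimg) (Or.inr hct)
  have hR : Tendsto (fun n => 2 ^ (q - 1) * (ENNReal.ofReal τ * eLpNorm (φ n) p σ ^ q +
      ENNReal.ofReal τ ^ q * (c * eLpNorm (fderiv ℝ (φ n)) p (μ.restrict S) ^ q))) atTop
      (𝓝 (2 ^ (q - 1) * (ENNReal.ofReal τ * 0 ^ q +
        ENNReal.ofReal τ ^ q * (c * eLpNorm G p (μ.restrict S) ^ q)))) := by
    refine ENNReal.Tendsto.const_mul ?_ (Or.inr ?_)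
    · refine (ENNReal.Tendsto.const_mul (hpow hφ0) (Or.inr ENNReal.ofReal_ne_top)).add ?_
      exact ENNReal.Tendsto.const_mul (ENNReal.Tendsto.const_mul (hpow hlimG) (Or.inr hct))
        (Or.inr (ENNReal.rpow_ne_top_of_nonneg hq0.le ENNReal.ofReal_ne_top))
    · exact ENNReal.rpow_ne_top_of_nonneg (sub_nonneg.2 hq) ENNReal.ofNat_ne_top
  have hle := le_of_tendsto_of_tendsto' hL hR hn
  rw [ENNReal.zero_rpow_of_pos hq0, mul_zero, zero_add] at hle
  -- cancel the slicing constant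
  rw [lintegral_enorm_rpow_eq_eLpNorm_rpow hp0 hp', lintegral_enorm_rpow_eq_eLpNorm_rpow hp0 hp',
    ← ENNReal.mul_le_mul_iff_right hc0 hct]
  calc c * eLpNorm g p (μ.restrict S) ^ q
      ≤ 2 ^ (q - 1) * (ENNReal.ofReal τ ^ q * (c * eLpNorm G p (μ.restrict S) ^ q)) := hle
    _ = c * (2 ^ (q - 1) * ENNReal.ofReal τ ^ q * eLpNorm G p (μ.restrict S) ^ q) := by ring

end StripLimit

/-! ### Boundary patches are in `W₀^{1,p}(Ω)` -/

section Boundary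

variable {E' : Type*} [NormedAddCommGroup E'] [InnerProductSpace ℝ E'] [FiniteDimensional ℝ E']
  [MeasurableSpace E'] [BorelSpace E']
variable {F : Type*} [NormedAddCommGroup F] [NormedSpace ℝ F] [CompleteSpace F]

open LipGraph

omit [FiniteDimensional ℝ E'] [MeasurableSpace E'] [BorelSpace E'] in
/-- Strips are monotone in radius and height. [folklore] -/
theorem strip_mono {u : E'} {γ : E' → ℝ} {x₀ : E'} {ρ ρ' τ τ' : ℝ} (hρ : ρ ≤ ρ') (hτ : τ ≤ τ') :
    strip u γ x₀ ρ τ ⊆ strip u γ x₀ ρ' τ' := fun _ ⟨h1, h2, h3⟩ =>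
  ⟨ball_subset_ball hρ h1, h2, h3.trans_le hτ⟩


/-- **Zero-trace strip estimate, norm form**: under the hypotheses of
`LipGraph.setLIntegral_strip_enorm_rpow_le`,
`‖g‖_{L^p(strip)} ≤ 2 τ ‖G‖_{L^p(strip)}` (`p`-th roots; `2^{(p-1)/p} ≤ 2`)
(Evans, *PDE* (2010), §5.5, proof of Theorem 2, (10)). [folklore] -/
theorem eLpNorm_strip_le {u : E'} (hu : ‖u‖ = 1) {γ : E' → ℝ} (hγc : Continuous γ)
    {Ω : Opens E'} {x₀ : E'} {r : ℝ}
    (hΩ : (Ω : Set E') ∩ ball x₀ r = {y | y ∈ ball x₀ r ∧ γ (y - ⟪y, u⟫_ℝ • u) < ⟪y, u⟫_ℝ})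
    (μ : Measure E') [μ.IsAddHaarMeasure] {ρ τ : ℝ} (hτ : 0 < τ) (hρ : ρ + τ ≤ r) {p : ℝ≥0∞}
    (hp : 1 ≤ p) (hp' : p ≠ ⊤) {g : E' → F} {G : E' → E' →L[ℝ] F}
    (hgp : MemLp g p (μ.restrict Ω)) (hG : HasWeakFDerivOn Ω μ g G) {φ : ℕ → E' → F}
    (hφ : ∀ n, ContDiff ℝ 1 (φ n))
    (hφg : Tendsto (fun n => eLpNorm (g - φ n) p (μ.restrict Ω)) atTop (𝓝 0))
    (hφG : Tendsto (fun n => eLpNorm (fun x => G x - fderiv ℝ (φ n) x) p (μ.restrict Ω)) atTop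
      (𝓝 0))
    (hφ0 : Tendsto (fun n => eLpNorm (φ n) p
      (μH[((finrank ℝ E' - 1 : ℕ) : ℝ)].restrict (frontier (Ω : Set E')))) atTop (𝓝 0)) :
    eLpNorm g p (μ.restrict (strip u γ x₀ ρ τ)) ≤
      2 * ENNReal.ofReal τ * eLpNorm G p (μ.restrict (strip u γ x₀ ρ τ)) := by
  have hp0 : p ≠ 0 := (zero_lt_one.trans_le hp).ne'
  set q : ℝ := p.toReal with hq_def
  have hq : 1 ≤ q := by
    have := (ENNReal.toReal_le_toReal ENNReal.one_ne_top hp').2 hp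
    rwa [ENNReal.toReal_one] at this
  have hq0 : 0 < q := one_pos.trans_le hq
  have hiq : 0 ≤ 1 / q := by positivity
  have h := setLIntegral_strip_enorm_rpow_le hu hγc hΩ μ hτ hρ hp hp' hgp hG hφ hφg hφG hφ0
  rw [eLpNorm_eq_lintegral_rpow_enorm_toReal hp0 hp', eLpNorm_eq_lintegral_rpow_enorm_toReal hp0 hp']
  refine (ENNReal.rpow_le_rpow h hiq).trans ?_
  rw [ENNReal.mul_rpow_of_nonneg _ _ hiq, ENNReal.mul_rpow_of_nonneg _ _ hiq, ← ENNReal.rpow_mul,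
    ← ENNReal.rpow_mul, mul_one_div_cancel hq0.ne', ENNReal.rpow_one]
  gcongr
  calc (2 : ℝ≥0∞) ^ ((q - 1) * (1 / q)) ≤ 2 ^ (1 : ℝ) :=
        ENNReal.rpow_le_rpow_of_exponent_le one_le_two (by
          rw [mul_one_div, div_le_one hq0]; linarith)
    _ = 2 := ENNReal.rpow_one 2



omit [FiniteDimensional ℝ E'] [MeasurableSpace E'] [BorelSpace E'] in
/-- **Cutting off near the graph lands inside `Ω`**: in a chart `B(x₀, r)`, if `ρ` is supported in
`B(x₀, r/2)` and `ζ = 1` wherever the height is `≤ a`, `a > 0`, then `(1 - ζ) ρ` has (topological)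
support inside `Ω` — its support lies in the closed set `{height ≥ a} ∩ closedBall (x₀, r/2)`,
which lies in `Ω` by the chart equation. [folklore] -/
theorem tsupport_cutoff_mul_subset {Ω : Set E'} {x₀ u : E'} {r : ℝ} (hr : 0 < r) {γ : E' → ℝ}
    (hγc : Continuous γ)
    (hΩ : Ω ∩ ball x₀ r = {y | y ∈ ball x₀ r ∧ γ (y - ⟪y, u⟫_ℝ • u) < ⟪y, u⟫_ℝ})
    {ρ : E' → ℝ} (hρs : tsupport ρ ⊆ ball x₀ (r / 2)) {ζ : E' → ℝ} {a : ℝ} (ha : 0 < a)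
    (hζ1 : ∀ y, height u γ y ≤ a → ζ y = 1) :
    tsupport (fun y => (1 - ζ y) * ρ y) ⊆ Ω := by
  have hsub : support (fun y => (1 - ζ y) * ρ y) ⊆ {y | a ≤ height u γ y} ∩ closedBall x₀ (r / 2) := by
    intro y hy
    have hρy : ρ y ≠ 0 := fun h => hy (by simp [h])
    have hζy : ζ y ≠ 1 := fun h => hy (by simp [h])
    refine ⟨?_, ball_subset_closedBall (hρs (subset_tsupport _ hρy))⟩
    by_contra hlt
    exact hζy (hζ1 y (le_of_lt (not_le.1 hlt)))
  have hclosed : IsClosed ({y | a ≤ height u γ y} ∩ closedBall x₀ (r / 2)) :=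
    (isClosed_le continuous_const (continuous_height u hγc)).inter isClosed_closedBall
  refine (closure_minimal hsub hclosed).trans ?_
  rintro y ⟨hy1, hy2⟩
  have hyr : y ∈ ball x₀ r := closedBall_subset_ball (by linarith) hy2
  exact mem_of_lt hΩ hyr (sub_pos.1 (ha.trans_le hy1))



/-- **Boundary patches of a zero-trace function are in `W₀^{1,p}(Ω)`** (Evans, *PDE* (2010),
§5.5, Theorem 2, proof; Alt, *Linear functional analysis* (2016), A8.10): in a chart
`B(x₀, r)` of a Lipschitz domain, let `f ∈ W^{1,p}(Ω)`, `1 ≤ p < ∞`, admit `C¹` approximants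
`φₙ → f` in `W^{1,p}(Ω)` with `‖φₙ‖_{L^p(∂Ω, μH[n-1])} → 0`, and let `ρ ∈ C_c^∞(B(x₀, r/2))`. Then
`ρ f ∈ W₀^{1,p}(Ω)`. Proof as in Evans: with smooth cut-offs `ζ_m` equal to `1` below height
`τ_m/8` and to `0` above height `3τ_m/4` over the graph, `|Dζ_m| ≤ C/τ_m` (`exists_smooth_cutoff`),
the functions `(1 - ζ_m) ρ f` are compactly supported in `Ω`, hence in `W₀^{1,p}(Ω)`
(`memSobolevDomainZero_smul_of_tsupport_subset`), and `ρ f - (1 - ζ_m) ρ f = ζ_m ρ f → 0` in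
`W^{1,p}(Ω)`: all terms of `ζ_m ρ f` and of `D(ζ_m ρ f) = ζ_m D(ρ f) + Dζ_m ⊗ ρ f` live in the
strip of height `τ_m`, where `‖ρ f‖_{L^p} ≤ 2 τ_m ‖D(ρ f)‖_{L^p}` by the zero-trace strip estimate,
which compensates `|Dζ_m| ≤ C/τ_m`, and `‖D(ρ f)‖_{L^p(strip)} → 0`. [cite: Evans2010, §5.5 Theorem 2 (proof)] -/
theorem memSobolevDomainZero_smul_of_chart {Ω : Opens E'} {x₀ u : E'} {r : ℝ} (hr : 0 < r)
    (hu : ‖u‖ = 1) {γ : E' → ℝ} {K : ℝ≥0} (hγ : LipschitzWith K γ)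
    (hΩ : (Ω : Set E') ∩ ball x₀ r = {y | y ∈ ball x₀ r ∧ γ (y - ⟪y, u⟫_ℝ • u) < ⟪y, u⟫_ℝ})
    (μ : Measure E') [μ.IsAddHaarMeasure] {p : ℝ≥0∞} (hp : 1 ≤ p) (hp' : p ≠ ⊤) {f : E' → F}
    (hf : MemSobolevDomain 1 p Ω μ f) {φ : ℕ → E' → F} (hφ : ∀ n, ContDiff ℝ 1 (φ n))
    (hφf : Tendsto (fun n => eSobolevDomainNorm 1 p Ω μ (f - φ n)) atTop (𝓝 0))
    (hφ0 : Tendsto (fun n => eLpNorm (φ n) p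
      (μH[((finrank ℝ E' - 1 : ℕ) : ℝ)].restrict (frontier (Ω : Set E')))) atTop (𝓝 0))
    {ρ : E' → ℝ} (hρ : ContDiff ℝ ∞ ρ) (hρc : HasCompactSupport ρ)
    (hρs : tsupport ρ ⊆ ball x₀ (r / 2)) :
    MemSobolevDomainZero p Ω μ (fun x => ρ x • f x) := by
  have hp0 : p ≠ 0 := (zero_lt_one.trans_le hp).ne'
  -- the data: `g = ρ f`, its weak derivative `G`
  have hgW : MemSobolevDomain 1 p Ω μ (fun x => ρ x • f x) :=
    SobolevApprox.memSobolevDomain_smul hf hρ hρc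
  obtain ⟨hf0, Df, hDf, hDfp⟩ := hf
  have hf' : MemSobolevDomain 1 p Ω μ f := ⟨hf0, Df, hDf, hDfp⟩
  set g : E' → F := fun x => ρ x • f x with hg_def
  set G : E' → E' →L[ℝ] F := fun x => ρ x • Df x + (fderiv ℝ ρ x).smulRight (f x) with hG_def
  have hG : HasWeakFDerivOn Ω μ g G := SobolevApprox.hasWeakFDerivOn_smul hDf hρ
  have hgp : MemLp g p (μ.restrict Ω) := hgW.memLp
  simp only [memSobolevDomain_zero_iff] at hDfp
  have hGv : ∀ v, MemLp (fun x => G x v) p (μ.restrict Ω) := by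
    intro v
    have heq : (fun x => G x v) = (fun x => ρ x • Df x v) + fun x => (fderiv ℝ ρ x v) • f x := by
      ext x
      simp [hG_def, ContinuousLinearMap.smulRight_apply]
    rw [heq]
    refine (SobolevApprox.memLp_continuous_smul hρ.continuous hρc (hDfp v)).add
      (SobolevApprox.memLp_continuous_smul ((hρ.continuous_fderiv (by simp)).clm_apply
        continuous_const) ?_ hf0)
    exact (hρc.fderiv ℝ).mono fun x hx => fun h0 => hx (by simp [h0])
  have hGp : MemLp G p (μ.restrict Ω) :=
    SobolevApprox.memLp_of_forall_memLp_apply hG.locallyIntegrableOn_deriv.aestronglyMeasurable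
      hGv hp
  -- Step 1: the `C¹` approximants `ρ φₙ` of `g`
  obtain ⟨C₀, hC₀⟩ := hρ.continuous.bounded_above_of_compact_support hρc
  have hgn : ∀ n, ContDiff ℝ 1 (fun x => ρ x • φ n x) := fun n => (hρ.of_le (by simp)).smul (hφ n)
  have h1 : Tendsto (fun n => eLpNorm (g - fun x => ρ x • φ n x) p (μ.restrict Ω)) atTop (𝓝 0) := by
    have hfφ : Tendsto (fun n => eLpNorm (f - φ n) p (μ.restrict Ω)) atTop (𝓝 0) :=
      tendsto_of_tendsto_of_tendsto_of_le_of_le tendsto_const_nhds hφf (fun _ => zero_le)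
        fun _ => eLpNorm_le_eSobolevDomainNorm
    refine (tendsto_eLpNorm_smul_of_tendsto hfφ hC₀).congr fun n => ?_
    congr 1
    ext x
    simp [hg_def, smul_sub]
  have h2 := tendsto_eLpNorm_deriv_smul_sub μ hp hf0 hDf hφ hφf hρ hρc
  have h3 : Tendsto (fun n => eLpNorm (fun x => ρ x • φ n x) p
      (μH[((finrank ℝ E' - 1 : ℕ) : ℝ)].restrict (frontier (Ω : Set E')))) atTop (𝓝 0) :=
    tendsto_eLpNorm_smul_of_tendsto hφ0 hC₀
  -- Step 2: the cut-offs and the strips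
  have hθ : LipschitzWith K (γ ∘ proj u) := by simpa using hγ.comp (lipschitzWith_proj hu)
  obtain ⟨C, hC0, hcut⟩ := exists_smooth_cutoff hu hθ μ
  set τ : ℕ → ℝ := fun m => r / 4 * (1 / ((m : ℝ) + 1)) with hτ_def
  have hτ : ∀ m, 0 < τ m := fun m => by positivity
  have hτle : ∀ m, τ m ≤ r / 4 := fun m => by
    have h1 : 1 / ((m : ℝ) + 1) ≤ 1 := by
      rw [div_le_one (by positivity)]; linarith [m.cast_nonneg (α := ℝ)]
    calc τ m = r / 4 * (1 / ((m : ℝ) + 1)) := rfl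
      _ ≤ r / 4 * 1 := by gcongr
      _ = r / 4 := mul_one _
  have hτlim : Tendsto τ atTop (𝓝 0) := by
    have := tendsto_one_div_add_atTop_nhds_zero_nat.const_mul (r / 4)
    rwa [mul_zero] at this
  have hτanti : Antitone τ := fun m m' hmm' => by
    simp only [hτ_def]
    gcongr
  choose ζ hζs hζ01 hζ1 hζ0 hζD using fun m => hcut (τ m) (hτ m)
  have hheight : ∀ y, ⟪y, u⟫_ℝ - (γ ∘ proj u) y = height u γ y := fun y => rfl
  simp only [hheight] at hζ1 hζ0
  set S : ℕ → Set E' := fun m => strip u γ x₀ (r / 2 + τ m) (τ m) with hS_def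
  have hSΩ : ∀ m, S m ⊆ (Ω : Set E') := fun m y hy =>
    (strip_subset hu hΩ (by linarith [hτle m]) hy).1
  have hSm : ∀ m, MeasurableSet (S m) := fun m => measurableSet_strip u hγ.continuous x₀ _ _
  have hmemS : ∀ m, ∀ y ∈ (Ω : Set E'), y ∈ tsupport ρ → height u γ y < τ m → y ∈ S m :=
    fun m y hyΩ hyρ hlt => mem_strip_of_mem hu hΩ (by linarith) hyΩ (hρs hyρ) hlt
  have hζne : ∀ m y, ζ m y ≠ 0 → height u γ y < τ m := fun m y h => by
    by_contra hge
    exact h (hζ0 m y (by linarith [not_lt.1 hge, hτ m]))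
  have hDζne : ∀ m y, fderiv ℝ (ζ m) y ≠ 0 → height u γ y < τ m := fun m y h => by
    by_contra hge
    have hev : ζ m =ᶠ[𝓝 y] fun _ => 0 := by
      filter_upwards [(isOpen_lt continuous_const (continuous_height u hγ.continuous)).mem_nhds
        (show 3 * τ m / 4 < height u γ y by linarith [not_lt.1 hge, hτ m])] with z hz
      exact hζ0 m z hz.le
    exact h (by rw [hev.fderiv_eq, fderiv_const_apply])
  -- `g` and `G` vanish off `tsupport ρ`
  have hg0 : ∀ y, y ∉ tsupport ρ → g y = 0 := fun y hy => by
    simp [hg_def, image_eq_zero_of_notMem_tsupport hy]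
  have hG0 : ∀ y, y ∉ tsupport ρ → G y = 0 := fun y hy => by
    simp [hG_def, image_eq_zero_of_notMem_tsupport hy, fderiv_of_notMem_tsupport ℝ hy]
  -- Step 3: the compactly supported cut-offs `χ m = (1 - ζ m) ρ` and `χ m • f ∈ W₀`
  have hW0 : ∀ m, MemSobolevDomainZero p Ω μ (fun x => ((1 - ζ m x) * ρ x) • f x) := fun m =>
    memSobolevDomainZero_smul_of_tsupport_subset hp hp' hf' ((contDiff_const.sub (hζs m)).mul hρ)
      hρc.mul_left (tsupport_cutoff_mul_subset hr hγ.continuous hΩ hρs (by positivity) (hζ1 m))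
  -- Step 4: `g - χ m • f = ζ m • g` and its `W^{1,p}` norm
  have hid : ∀ m, (g - fun x => ((1 - ζ m x) * ρ x) • f x) = fun x => ζ m x • g x := by
    intro m
    ext x
    simp only [hg_def, Pi.sub_apply, sub_mul, one_mul, sub_smul, mul_smul]
    abel
  set X : ℕ → ℝ≥0∞ := fun m => eLpNorm G p (μ.restrict (S m)) with hX_def
  have hstrip : ∀ m, eLpNorm g p (μ.restrict (S m)) ≤ 2 * ENNReal.ofReal (τ m) * X m := fun m =>
    eLpNorm_strip_le hu hγ.continuous hΩ μ (hτ m) (by linarith [hτle m]) hp hp' hgp hG hgn h1 h2 h3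
  have hζabs : ∀ m y, |ζ m y| ≤ 1 := fun m y =>
    abs_le.2 ⟨by linarith [(hζ01 m y).1], (hζ01 m y).2⟩
  set b := Module.finBasis ℝ E'
  set A : ℝ≥0∞ := 2 * ENNReal.ofReal (r / 4) +
    ∑ i, (ENNReal.ofReal ‖b i‖ + 2 * ENNReal.ofReal (C * ‖b i‖)) with hA
  have hbound : ∀ m, eSobolevDomainNorm 1 p Ω μ (fun x => ζ m x • g x) ≤ A * X m := by
    intro m
    refine (eSobolevDomainNorm_cutoff_smul_le hp hG hg0 hG0 (hSm m) (hSΩ m) (hζs m) (hζabs m)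
      (hζD m) (fun y hyΩ hyρ h => hmemS m y hyΩ hyρ (hζne m y h))
      (fun y hyΩ hyρ h => hmemS m y hyΩ hyρ (hDζne m y h))).trans ?_
    have hτC : ∀ i, ENNReal.ofReal (C / τ m * ‖b i‖) * (2 * ENNReal.ofReal (τ m)) =
        2 * ENNReal.ofReal (C * ‖b i‖) := fun i => by
      have hτ0 : (τ m) ≠ 0 := (hτ m).ne'
      rw [mul_left_comm, ← ENNReal.ofReal_mul (by positivity),
        show C / τ m * ‖b i‖ * τ m = C * ‖b i‖ by field_simp]
    calc eLpNorm g p (μ.restrict (S m)) + ∑ i, (ENNReal.ofReal ‖b i‖ * X m +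
          ENNReal.ofReal (C / τ m * ‖b i‖) * eLpNorm g p (μ.restrict (S m)))
        ≤ 2 * ENNReal.ofReal (τ m) * X m + ∑ i, (ENNReal.ofReal ‖b i‖ * X m +
          ENNReal.ofReal (C / τ m * ‖b i‖) * (2 * ENNReal.ofReal (τ m) * X m)) := by
          gcongr
          · exact hstrip m
          · exact hstrip m
      _ = (2 * ENNReal.ofReal (τ m) + ∑ i, (ENNReal.ofReal ‖b i‖ + 2 * ENNReal.ofReal (C * ‖b i‖))) *
          X m := by
          rw [add_mul, Finset.sum_mul]
          congr 1
          refine Finset.sum_congr rfl fun i _ => ?_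
          rw [add_mul, ← hτC i]
          ring
      _ ≤ A * X m := by
          rw [hA]
          gcongr
          exact hτle m
  -- `X m → 0`
  have hanti : Antitone S := fun m m' hmm' =>
    strip_mono (by linarith [hτanti hmm']) (hτanti hmm')
  have hinter : ⋂ m, S m = ∅ := by
    refine eq_empty_of_forall_notMem fun y hy => ?_
    rw [mem_iInter] at hy
    have hle : height u γ y ≤ 0 := ge_of_tendsto' hτlim fun m => (hy m).2.2.le
    exact lt_irrefl _ ((hy 0).2.1.trans_le hle)
  have hX : Tendsto X atTop (𝓝 0) := by
    have hfin : (μ.restrict (Ω : Set E')) (S 0) ≠ ⊤ :=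
      ((Measure.restrict_le_self _).trans_lt ((measure_mono ((strip_subset hu hΩ
        (by linarith [hτle 0])).trans inter_subset_right)).trans_lt measure_ball_lt_top)).ne
    have h := tendsto_eLpNorm_restrict_of_antitone hp0 hp' hGp hSm hanti hinter hfin
    refine h.congr fun m => ?_
    rw [hX_def, Measure.restrict_restrict (hSm m), inter_eq_left.2 (hSΩ m)]
  have hAt : A ≠ ⊤ := by
    rw [hA]
    refine ENNReal.add_ne_top.2 ⟨ENNReal.mul_ne_top ENNReal.ofNat_ne_top ENNReal.ofReal_ne_top,
      ENNReal.sum_ne_top.2 fun i _ => ENNReal.add_ne_top.2 ⟨ENNReal.ofReal_ne_top,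
        ENNReal.mul_ne_top ENNReal.ofNat_ne_top ENNReal.ofReal_ne_top⟩⟩
  -- Step 5: conclusion
  refine memSobolevDomainZero_of_tendsto hp hgW hW0 ?_
  simp only [hid]
  refine tendsto_of_tendsto_of_tendsto_of_le_of_le tendsto_const_nhds ?_ (fun _ => zero_le) hbound
  simpa using ENNReal.Tendsto.const_mul hX (Or.inr hAt)

end Boundary

/-! ### Assembly: functions with vanishing trace are in `W₀^{1,p}(Ω)` -/

section Final

variable {E' : Type*} [NormedAddCommGroup E'] [InnerProductSpace ℝ E'] [FiniteDimensional ℝ E']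
  [MeasurableSpace E'] [BorelSpace E']
variable {F : Type*} [NormedAddCommGroup F] [NormedSpace ℝ F] [CompleteSpace F]

/-- **Functions with vanishing trace belong to `W₀^{1,p}(Ω)`** (Alt, *Linear functional
analysis* (2016), A8.10 Lemma, inclusion `⊇`: "`W₀^{1,p}(Ω) = {u ∈ W^{1,p}(Ω) ; Su = 0}`";
Evans, *PDE* (2010), §5.5, Theorem 2 for `C¹` boundaries), in sequential form: on a bounded
Lipschitz domain `Ω`, for `1 ≤ p < ∞`, an additive Haar measure `μ` and complete `F`, if
`f ∈ W^{1,p}(Ω; F)` is the `W^{1,p}(Ω)`-limit of `C¹` functions `φₙ` whose restrictions to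
`∂Ω` tend to `0` in `L^p(∂Ω, μH[n-1])`, then `f ∈ W₀^{1,p}(Ω)`. Proof (Evans, §5.5, proof of
Theorem 2, with Lipschitz charts): a smooth partition of unity `ρᵢ` on `Ω̄` subordinate to `Ω`
and to half chart balls (`SmoothPartitionOfUnity.exists_isSubordinate`); the interior piece
`ρ₀ f` is in `W₀^{1,p}(Ω)` by mollification (`memSobolevDomainZero_smul_of_tsupport_subset`),
each boundary piece by `memSobolevDomainZero_smul_of_chart`, and `f = Σᵢ ρᵢ f` on `Ω`.
This is the statement of the named fact `Literature.Analysis.FunctionSpaces.memSobolevDomainZero_of_tendsto_trace_zero`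
(`SobolevTraceOperator`). [cite: Alt2016, A8.10 Lemma (inclusion ⊇)] [cite: Evans2010, §5.5 Theorem 2 (proof)] -/
theorem memSobolevDomainZero_of_tendsto_trace_zero' {Ω : Opens E'} (hΩ : IsLipschitzDomain Ω)
    (hb : IsBounded (Ω : Set E')) {p : ℝ≥0∞} (hp : 1 ≤ p) (hp' : p ≠ ⊤) (μ : Measure E')
    [μ.IsAddHaarMeasure] {f : E' → F} (hf : MemSobolevDomain 1 p Ω μ f) (φ : ℕ → E' → F)
    (hφ : ∀ n, ContDiff ℝ 1 (φ n))
    (hφf : Tendsto (fun n => eSobolevDomainNorm 1 p Ω μ (f - φ n)) atTop (𝓝 0))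
    (hφ0 : Tendsto (fun n => eLpNorm (φ n) p (surfaceMeasure Ω)) atTop (𝓝 0)) :
    MemSobolevDomainZero p Ω μ f := by
  rw [surfaceMeasure_def] at hφ0
  -- Lipschitz charts at the boundary points
  choose! r hr hchart using hΩ
  -- the compact boundary is covered by finitely many half-balls of charts
  have hK : IsCompact (frontier (Ω : Set E')) :=
    hb.isCompact_closure.of_isClosed_subset isClosed_frontier frontier_subset_closure
  obtain ⟨t, htf, hcover⟩ := hK.elim_nhds_subcover (fun x => ball x (r x / 2))
    fun x hx => ball_mem_nhds x (half_pos (hr x hx))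
  -- the open cover of `closure Ω` indexed by `Option t`: `Ω` itself and the half-balls
  let V : Option t → Set E' := fun i => i.elim (Ω : Set E') fun x => ball (x : E') (r x / 2)
  have hVo : ∀ i, IsOpen (V i) := by
    rintro (_ | ⟨x, hx⟩)
    exacts [Ω.isOpen, isOpen_ball]
  have hVb : ∀ i, IsBounded (V i) := by
    rintro (_ | ⟨x, hx⟩)
    exacts [hb, isBounded_ball]
  have hVc : closure (Ω : Set E') ⊆ ⋃ i, V i := by
    intro y hy
    rw [closure_eq_self_union_frontier] at hy
    rcases hy with hy | hy
    · exact mem_iUnion.2 ⟨none, hy⟩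
    · obtain ⟨x, hxt, hyx⟩ := mem_iUnion₂.1 (hcover hy)
      exact mem_iUnion.2 ⟨some ⟨x, hxt⟩, hyx⟩
  obtain ⟨ρ, hρ⟩ := SmoothPartitionOfUnity.exists_isSubordinate (I := 𝓘(ℝ, E')) (M := E')
    isClosed_closure V hVo hVc
  have hρs : ∀ i, ContDiff ℝ ∞ (ρ i) := fun i => contMDiff_iff_contDiff.1 (ρ i).contMDiff
  have hρc : ∀ i, HasCompactSupport (ρ i) := fun i =>
    Metric.isCompact_of_isClosed_isBounded (isClosed_tsupport _) ((hVb i).subset (hρ i))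
  -- each patch is in `W₀^{1,p}(Ω)`
  have hpatch : ∀ i, MemSobolevDomainZero p Ω μ (fun x => ρ i x • f x) := by
    rintro (_ | ⟨x₀, hx₀⟩)
    · exact memSobolevDomainZero_smul_of_tsupport_subset hp hp' hf (hρs none) (hρc none) (hρ none)
    · obtain ⟨u, hu, γ, K, hγ, hΩx⟩ := hchart x₀ (htf x₀ hx₀)
      exact memSobolevDomainZero_smul_of_chart (hr x₀ (htf x₀ hx₀)) hu hγ hΩx μ hp hp' hf hφ hφf
        hφ0 (hρs _) (hρc _) (hρ (some ⟨x₀, hx₀⟩))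
  -- `f = Σᵢ ρᵢ f` on `Ω`
  have hsum : MemSobolevDomainZero p Ω μ (∑ i, fun x => ρ i x • f x) :=
    memSobolevDomainZero_sum hp Finset.univ fun i _ => hpatch i
  refine memSobolevDomainZero_congr_eqOn hsum hf fun x hx => ?_
  have h1 : ∑ i, ρ i x = 1 := by
    have := ρ.sum_eq_one (subset_closure hx)
    rwa [finsum_eq_sum_of_fintype] at this
  simp only [Finset.sum_apply, ← Finset.sum_smul, h1, one_smul]

end Final

end TraceZero

/-! ### The discharges -/

section Discharges

variable {E' : Type*} [NormedAddCommGroup E'] [InnerProductSpace ℝ E'] [MeasurableSpace E']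
  [BorelSpace E'] [FiniteDimensional ℝ E']
variable {F : Type*} [NormedAddCommGroup F] [NormedSpace ℝ F]

variable (F) in
/-- **Discharge** of the named fact `eLpNorm_surfaceMeasure_le_of_contDiff`
(`SobolevTraceOperator`): the trace inequality `‖f‖_{L^p(∂Ω)} ≤ C (‖f‖_{L^p(Ω)} + ‖Df‖_{L^p(Ω)})`
for `C¹` functions on a bounded Lipschitz domain, `1 ≤ p < ∞`
(`LipGraph.exists_eLpNorm_surfaceMeasure_le_of_contDiff`, `SobolevTraceGraph`; Evans–Gariepy
(1992), §4.3, Theorem 1, proof, estimate `(⋆⋆⋆)`). [cite: EvansGariepy1992, §4.3 Theorem 1 (proof, estimate (⋆⋆⋆))] -/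
theorem eLpNorm_surfaceMeasure_le_of_contDiff_holds :
    eLpNorm_surfaceMeasure_le_of_contDiff (E' := E') F :=
  fun hΩ hb p hp hp' μ _ => LipGraph.exists_eLpNorm_surfaceMeasure_le_of_contDiff hΩ hb p hp hp' μ

variable (F) in
/-- **Discharge** of the named fact `memSobolevDomainZero_of_tendsto_trace_zero`
(`SobolevTraceOperator`): functions with vanishing trace belong to `W₀^{1,p}(Ω)`
(`TraceZero.memSobolevDomainZero_of_tendsto_trace_zero'`; Alt (2016), A8.10 Lemma,
inclusion `⊇`; Evans (2010), §5.5, Theorem 2). [cite: Alt2016, A8.10 Lemma (inclusion ⊇)] -/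
theorem memSobolevDomainZero_of_tendsto_trace_zero_holds :
    memSobolevDomainZero_of_tendsto_trace_zero (E' := E') F := by
  intro _ Ω hΩ hb p hp hp' μ _ f hf φ hφ hφf hφ0
  exact TraceZero.memSobolevDomainZero_of_tendsto_trace_zero' hΩ hb hp hp' μ hf φ hφ hφf hφ0

variable (F) in
/-- **The trace theorem on bounded Lipschitz domains** — discharge of the named fact
`Literature.Analysis.FunctionSpaces.trace_theorem` (`SobolevTrace`) for complete `F`: for `Ω` bounded with Lipschitz boundary,
`1 ≤ p < ∞` and an additive Haar measure `μ`, there is a bounded, a.e.-linear trace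
`W^{1,p}(Ω; F) → L^p(∂Ω, μH[n-1]; F)` restricting smooth functions and with kernel exactly
`W₀^{1,p}(Ω)`, i.e. `TraceData F Ω p μ (surfaceMeasure Ω)` is inhabited (E. Gagliardo, Rend.
Sem. Mat. Univ. Padova 27 (1957); Evans, *PDE* (2010), §5.5, Theorems 1–2; Alt (2016), A8.6 and
A8.10; Grisvard (1985), Thm. 1.5.1.3). The two analytic inputs of `trace_theorem_of_parts`
(`SobolevTraceOperator`) are `eLpNorm_surfaceMeasure_le_of_contDiff_holds` and
`memSobolevDomainZero_of_tendsto_trace_zero_holds`. See the module docstring on completeness.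
[cite: Evans2010, §5.5 Theorems 1–2] [cite: Alt2016, A8.6 and A8.10] -/
theorem trace_theorem_holds [CompleteSpace F] : trace_theorem (E' := E') F :=
  trace_theorem_of_parts (eLpNorm_surfaceMeasure_le_of_contDiff_holds F)
    (memSobolevDomainZero_of_tendsto_trace_zero_holds F)

end Discharges

end Literature.Analysis.FunctionSpaces
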